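import Summits.Langlands.Langlands.Theses.IrreducibilityBySelfDuality
import Literature.NumberTheory.Automorphic.KimExteriorSquareGL4ArchimedeanTwist
import Summits.Langlands.Langlands.Theorems.HalfIntegralTwistCM.Negative.ArchParameterGLOne

/-!
# Disproof workfile for crux `RegularTwistCM` (stmt-Langlands-14069) — standing adversary

Route: `route-Langlands-IrreducibilityBySelfDuality`, decl
`Summit.Langlands.Langlands.Theses.IrreducibilityBySelfDuality.RegularTwistCM` (rank 3).

## Findings (cycle 1, refuter-cdisprove-stmt-Langlands-14069-0, 2026-08-16)

* **F0 (elaboration).** The decl elaborates (probe rc 0, one sorry); the ledger signature is the decl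
  verbatim. Read back symbol by symbol: `K` CM (Mathlib `NumberField.IsCMField`, explicit arrow);
  `π`/`σ₀`/`ν` Borel–Jacquet data on `GL₃/GL₂/GL₁` (`CuspidalAutomorphicRepData n K hcpt`, a subtype of
  the honest `AutomorphicRepData`: `W' < W` stable, irreducible quotient, `W ≤` cusp forms);
  `HasSatakeParamAt v α` forces `card α = n`, level prime to `v` (so GL(1) values `χ_v(ϖ)` are
  uniformizer-independent); `Ad β = ((β ×ˢ β).map (p.1 * p.2⁻¹)).erase 1` has card 3 for `card β = 2`
  (`{x/y, y/x, 1}`; `{1,1,1}` when `x = y`); `IsRegularAlgebraic` = ∃ infinity type `T`, well formed,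
  `a`-parts = the Harish-Chandra parameter of the honest Lie action (`HasLieAction` pins `ρ𝔤` to the
  Lie derivative — no junk `ρ𝔤 = 0`), `a, b ∈ (n-1)/2 + ℤ`, `a`'s distinct at EVERY embedding (so at a
  complex place both the `id`- and the `conj`-copy are constrained). No coercion / junk-operator / order
  slip found. Quantifier order matches the informal text (∃ σ χ after all hypotheses; cofinite filters
  absorb the finitely many places where the constructed `χ` ramifies).
* **F1 (no Lean counter-model is possible in this tree).** `¬ RegularTwistCM` needs an explicit CM field
  `K` AND explicit `π : CuspidalAutomorphicRepData 3 K hcpt` with a PROOF of `π.1.IsRegularAlgebraic`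
  (a `HasLieAction`/`HasHCParameter` certificate for genuine cusp forms on `GL₃(𝔸_K)`): constant
  functions are automorphic but not cuspidal for `n ≥ 2` (non-zero constant term), and nothing else is
  constructible here. Hence every negative result below is either (i) a paper theorem recorded as a
  sorried near-miss with its witnesses named, or (ii) a sorry-free lemma about the ARCHIMEDEAN SHADOW
  (the exponent/unit bookkeeping that decides the statement once the standard inputs are granted).
  Symmetrically the crux is unprovable until a twist `σ₀ ⊗ χ` by an infinite-order non-unitary Hecke
  character exists as a `CuspidalAutomorphicRepData` with shifted `HasArchParameter` (tree twist API is
  finite-order only) — this is formalisation depth, not a truth defect.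
* **F2 (verdict on paper: RESISTS; = Patrikis arXiv:1207.6724 Prop. 1.3.1 read on (GL₂, SL₂)).**
  At a complex place `w`, `π_w ≅ Ad(σ₀,w) ⊗ ν_w` (GJ Thm 9.3 at ∞ + JS II Thm 4.4) and `π` RA force
  `σ₀,w = PS(z^{s₁} z̄^{t₁}, z^{s₂} z̄^{t₂})` with `a_w = s₁-s₂ ∈ ℤ∖{0}`, `b_w = t₁-t₂ ∈ ℤ∖{0}`.
  CORRECTION to the route text: Clozel purity (Lemme 4.9) is NOT needed — `σ₀` cuspidal ⇒ `σ₀,w` is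
  unitary up to `|det|^{s'}`; complementary series are excluded by `a_w ∈ ℤ` (they have
  `a_w = b_w = 2σ ∈ (0,1)`), and for a unitary principal series `s_i = (k_i + i y_i)/2 + s'`,
  `t_i = (-k_i + i y_i)/2 + s'`, so `a_w ∈ ℤ` forces `y₁ = y₂`, `k₁ ≡ k₂ (2)` and then `b_w = -a_w`
  AUTOMATICALLY. Local twist: `χ_w = z^{1/2-s₁} z̄^{1/2-t₁}` (lemma `complexPlace_twist_exists`), modulus
  exponent `u_w + v_w = 1 - Σ_w/2`, `Σ_w = s₁+s₂+t₁+t₂` the exponent of `ω_{σ₀,w}` on `ℝ_{>0}`.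
  SECOND CORRECTION: `Σ_w` is NOT place-independent — only `Re Σ_w` is (Weil's criterion for the Hecke
  character `ω_{σ₀}` on the totally positive units of `K⁺`: `x ↦ Σ_w Σ_w x_w` maps the unit log-lattice
  `Λ ⊂ {Σ x_w = 0}` into `2πiℤ`, which forces `(Re Σ_w)_w ∥ (1,…,1)` but only a LATTICE condition on
  `(Im Σ_w)_w` — Maass-type Grössencharaktere, e.g. `K⁺` real quadratic, `Im Σ = ±2πk/log ε`). The proof
  survives because `χ_∞` restricted to totally positive `K⁺`-units is `u ↦ exp(-(1/2) Σ_w Σ_w log u_w)`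
  (times `N(u)^{1} = 1`), which is trivial on the SQUARES `U²` of the finite-index subgroup `U` where
  `ω_{σ₀,∞}` is trivial (`squares_trick`; index 2 is genuinely needed in general: `squares_trick_tight`).
  `U²` has finite index in `𝓞_K^×` exactly because `K` is CM (`rk 𝓞_K^× = rk 𝓞_{K⁺}^×` and `K⁺`-units
  are REAL at every complex place, so the angular exponents `u_w - v_w = -k₁` are invisible) — Weil 1956
  / Patrikis Lemma 2.1.1 + Chevalley 1951 then give the Hecke character `χ`, and `σ₀ ⊗ χ` is regular
  algebraic (exponents `1/2`, `1/2 - a_w`; `1/2`, `1/2 + a_w`).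
* **F3 (load-bearing hypotheses; each dropped in turn — all needed).**
  - `IsCMField`: FALSE over totally real `K` (def `RegularTwistCMWithoutIsCMField`; witness: a non-CM
    Hilbert newform `σ₀` of weights `(2,3)` over `ℚ(√2)` — exists by Patrikis Lemma on p. 32 "over any
    totally real field non-CM mixed parity Hilbert modular forms exist"; `π := Ad(σ₀)` is RA cuspidal on
    `GL₃`; NO twist of `σ₀` is C-algebraic: sorry-free shadow `archShadow_mixedParity_obstructed`).
    Also false over totally imaginary non-CM `K` (Patrikis Lemma 2.1.5 / Remark 1.3.2: unit arguments at
    complex places are not killed on any finite-index subgroup).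
  - `π.1.IsRegularAlgebraic`: FALSE without it (def `RegularTwistCMWithoutRegularAlgebraic`; witness:
    `σ₀` a cuspidal `GL₂` form over an imaginary quadratic `K` with `σ₀,w = PS(|z|_ℂ^{ir}, |z|_ℂ^{-ir})`,
    `r ≠ 0` (Maass type), `π := Ad(σ₀)`, `ν := 1`; every twist has `a`-exponents `{u+ir, u-ir}`, never
    both in `1/2 + ℤ`: shadow `maassType_noAlgebraicTwist`). Regularity alone (keeping algebraicity of
    `π`) is also needed: `a_w = 0` (e.g. `k₁ = k₂`, `y₁ = y₂`) gives C-algebraic but non-regular twists.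
  - the a.e. identity `t_π = d · Ad(t_{σ₀})`: without it `σ₀` is unconstrained (same Maass witness).
  - cuspidality of `σ₀` (built into the type): used twice — unitarity up to twist at `∞` (purity for
    free) and automorphy of `ω_{σ₀}` (the lattice condition on `Im Σ_w`); a bare archimedean parameter
    with `Re Σ_w` non-parallel would break the unit condition.
* **F4 (natural strengthenings that are FALSE on paper — provers must not drift into them).**
  - `χ` regular algebraic / unitary / finite order (def `RegularTwistCMAlgebraicTwist`): false —
    `σ₀ := σ_alg ⊗ |det|^{iy}`, `y ≠ 0`, satisfies the hypotheses with `π = Ad(σ_alg)`, and every RA twist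
    of `σ₀` uses `χ = |·|^{-iy} · (algebraic)`.
  - `σ := σ₀` (no twist): false, same witness.
  - a SINGLE `χ` working for all `σ₀` with the same `π`: false (the `y` above is `σ₀`-dependent).
  - NOT a strengthening-refutation: replacing C-algebraic by L-algebraic in the conclusion is ALSO true
    over CM (shift `χ_w` by `|z|_ℂ^{1/2}`: both parities are available at complex places — the a-priori
    `ρ`-shift hazard in `HasHCParameter` conventions is therefore moot for this crux; conventions were
    checked anyway: h.w. module of weight `λ` has parameter `λ + ρ`, trivial rep of `GL₂(ℂ)` has
    parameter `{1/2,-1/2}` = `weightZeroInfinityType 2`, C-algebraic, as Buzzard–Gee require).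
* **F5 (negatives / barriers).** `ledger negatives --problem Langlands`: 1 entry (K3 Kuga–Satake anchor),
  unrelated. Barrier catalogue (9 files): `NonRegularWeightBarrier` is conceded by hypothesis (and is
  exactly F3's second bullet); none other touches an archimedean twisting statement.

## Findings (cycle 2, refuter-cdisprove-stmt-Langlands-14069-g2-0, 2026-08-16) — details in §5

* **F6 (third correction: the EXACT archimedean input is CM parity).** Locally no relation between
  `a_w` and `b_w` is needed (`complexPlace_twist_exists_free`); globally the unit condition is soluble
  iff all `a_w + b_w` have the same parity (`cmParity_sufficient` / `cmParity_obstructed`, sorry-free,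
  quartic CM field with `K⁺ = ℚ(√2)`). Cuspidal `σ₀` supplies `a_w + b_w = 0` through LOCAL unitarity up
  to twist — the one use of cuspidality of `σ₀` at `∞` besides genericity; Clozel purity of `π` and
  place-independence of `Re Σ_w` are NOT used. Imaginary quadratic `K`: no unit condition at all
  (`unitCondition_trivial_of_finite`); first contentful case `[K:ℚ] = 4`.
* **F7 (literature anchor, pages read).** The crux on paper = Patrikis, *Variations on a theorem of
  Tate* (arXiv:1207.6724 / Mem. AMS 1238), Prop. 1.3.1(1) for `(GL₂, SL₂)` over CM (p. 46–47) +
  Labesse–Langlands, engine Def. 1.1.1 (p. 43) / Lemma 2.1.5(3) (p. 19) / Cor. 2.1.8(2) (p. 20, the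
  printed squares trick); oldest instance: Blasius–Rogawski's observation (quoted p. 30) that mixed-parity
  Hilbert modular forms acquire an L-algebraic twist after ANY CM base change. No printed counterexample.
* **F8 (strengthening refuted on paper).** `χ = |·|_𝔸^s · χ_alg` for one global `s` (def
  `RegularTwistCMGlobalPowerTwist`) is FALSE once `ω_{σ₀}` has a Maass-type component with `t_w`
  non-constant (`[K:ℚ] ≥ 4`); shadow `noGlobalExponent_of_maassType`. Checked NOT refutable: "σ unitary /
  tempered at ∞" (true, `n_w = -1`), "L-algebraic conclusion" (true, cycle 1).
* **F9 (junk worlds re-examined from the definitions, gen-2 fresh read).** `HasSatakeParamAt` quantifies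
  the level `𝔫` existentially (no level-one reading, so "χ must be unramified" is not implied);
  `IsRegularAlgebraic` is a pure infinitesimal-character condition (C-integral + `Nodup` at every
  embedding, pairing free by `IsWellFormed`); Mathlib's `IsCMField` = totally complex + quadratic over
  `K⁺`. Even in the hypothetical junk world where `CuspConditionGL` were vacuous (no measurable
  fundamental domain), the extra inhabitants (`𝟙`, `χ∘det`, Eisenstein `χ₁ ⊞ χ₂`) still SATISFY the crux on
  paper (CM twist freedom; for `χ₁ ⊞ χ₂`, `a_w + b_w = 2(r₁ - r₂)` is parallel by Weil) — no refutation
  "for the wrong reason" is available either. Verdict unchanged: RESISTS; no Lean counter-model (F1).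

## Findings (cycle 3, refuter-cdisprove-stmt-Langlands-14069-g3-0, 2026-08-16) — details in §6

* **F10 (cuspidality mutations).** `π` merely automorphic: still TRUE (Langlands' Prop. 2 + JS II 4.4 —
  every line consumes of `π` only its HC/Satake data); `σ₀` merely automorphic: still TRUE (new cases
  vacuous, JS II 4.4); BOTH merely automorphic: FALSE on paper (Eisenstein witness `μ ⊞ 𝟙`, `μ ⊞ 𝟙 ⊞ μ⁻¹`,
  `μ` of type `(z/|z|)²`; the conclusion's "`σ` cuspidal" is what breaks). Defs `RegularTwistCMAutomorphic{Pi,Sigma,Both}`.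
* **F11 (lever `UnitaryMirror` of line `unitary-mirror-parity`).** Cuspidality is load-bearing, temperedness
  is not: `mirror_offAxis_obstructed` / `mirror_onAxis` (sorry-free; Eisenstein `{s,-s}`); at `n = 1` the
  mirror is the pairing (`mirror_glOne_iff`).
* **F12 (TARGETS = all 17 stubs of the three filed skeletons, pre-assessed).** All TRUE on paper, none
  Lean-refutable, none mis-stated; edge instances (`n = 0` admitted in `S.stub_purity` /
  `S.stub_centralCharacterArch`, real places, any-field claims of `stub_centralSquareRoot`) checked
  harmless; `stub_descentArchPackage` silently contains `exists_hasInfinityType σ₀`. Table in §6.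
* **F13 (levers coincide; uniform constants unused).** Per embedding, mirror + C-algebraicity = multiset
  purity (`mirror_eq_purity_of_real`, `mirror_constant_integral`); `RegularTwistCM_of` of lines 1 and 3 use
  `S.stub_purity` / `UnitaryMirror` only per `ι` — both stubs can be localised (the uniformity is Weil's
  parallelism, never consumed here).
* **F14 (sharpness).** Only integral DIFFERENCES + regularity of `HC(π)` are used; integrality of the
  `ν`-exponent never — the crux holds for `π` regular with integral differences (weaker than RA).
* **F15 (literature).** searchd rc 75 again (search-degraded); galaxy bm25 (web PDFs) 15 hits, no
  counter-claim. Verdict: RESISTS (third cycle).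

## Findings (cycle 4, refuter-cdisprove-stmt-Langlands-14069-g4-0, 2026-08-16) — details in §7

* **F16 (TARGETS = the six stubs of the lead's RESHAPED picked skeleton `petersson-hermitian-purity`
  @ fc20f4a48ad5: `stub_adjointArchShadowNonDihedral` (1a), `stub_dihedralVacuity` (1b),
  `stub_descentInfinityType` (2), `stub_centralCharacterDatum` (3, all `n`), `stub_halfIntegralTwist`
  (4 = stmt-Langlands-14036 by name), `stub_twistRealisation` (5, all `n`)).** Independent re-attack with the
  definitions re-read (`IsWellFormed` = card + conj-swap ONLY, the pairing `a - b ∈ ℤ` lives in the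
  structure `ArchWeight`; `IsQuadraticSelfTwistAE`/`quadraticSign` via Mathlib `Ideal.inertiaDeg`;
  `hasArchParameter_unique`, `card_eq_of_hasArchParameter` proved): 0 stub-false, 0 stub-misstated,
  6 survive — concurring with drefute's `DrefutePeterssonHermitianPurity.md`. New sorry-free certificates
  (§7; landing as `Theorems/RegularTwistCM/Negative/AdjointShapeCertificates.lean`): 1a's typed conclusion
  `{x-y+q, q, y-x+q}` IS the `q`-shift of the additive adjoint of `{x, y}` (`adjointShape_eq`), symmetric
  in `x ↔ y` (well posed on the multiset `χσ ι`), carried by `exp` to the multiplicative `Ad` of the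
  hypothesis (`ad_pair`, `ad_pair_exp`), with entry sum `3q` (`ω_π = ν³` at `∞`, the sibling crux's
  CentreCube theme), `Nodup ↔ x ≠ y` and "integral ↔ `x - y ∈ ℤ ∧ q ∈ ℤ`" (exactly what RA of `π`
  yields — F14 made formal); 1b's one-place content: self-twist at an inert place ⟺ shape `{X, -X}`
  ⟹ `Ad = {-1, -1, 1}` (`selfTwist_pair_iff`, `ad_pair_neg`) — a legitimate local Satake datum, so the
  negation in 1b is purely GLOBAL (JS II Thm 4.4): no one-place counter-model, no local mis-statement;
  stub 2 has content ONLY at complex places (the diagonal type `{(x, x)}` works at every conj-fixed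
  embedding: `exists_hasInfinityType_of_conjugate_eq` / `_of_isTotallyReal`) — over the crux's CM field
  all of stub 2 is the integral pairing `χ σ ↔ χ σ̄`; stub 3 holds verbatim at `n = 1`
  (`centralCharacterDatum_glOne`) and, as typed for all `n`, IMPLIES the sum pairing
  `Σ P(σ_w) - Σ P(σ̄_w) ∈ ℤ` for every cuspidal `GL_n` datum (`sumPairing_of_centralCharacterDatum`, via
  the sibling's landed `archParam_embedding_sub_conj_mem_int_glOne`) — true on paper and consistent with
  stub 2; a mis-normalised `{Σ P ι + c_ι}` with `c_ι - c_ῑ ∉ ℤ` would have been caught here.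
* **F17 (nearest landed material per stub, for the lead).** 1a: `GelbartJacquet_adjoint_lift` (Satake
  level, same non-dihedral clause), `CuspidalAutomorphicRepData.hasArchParameter_eq_of_isNearlyEquivalent`
  (SMO∞), template `Kim2003_exteriorSquare_GL4_archimedean`; 1b: the Arthur–Clozel isobaric files
  (`false_of_isobaric_weakLift_of_lift`) and `hasSatakeParamAt_cofinite_holds` (defeats the vacuous reading
  of the negated a.e. clause); 2: `AutomorphicRepData.exists_hasArchParameter_of_hasInfinitesimalCharacter`
  (HarishChandraGLParameterOfCharacter) + the `GL₂(ℂ)` pairing (not in tree); 3: the sibling crux's LANDED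
  `Theorems/IrreducibilityBySelfDualityRegularAdjointLiftCMCentralCharacterInfinityType.lean`
  (`stub_centralCharacterInfinityType`, from `HasArchParameter.lieDeriv_scalar_sub_smul_mem` +
  `centralCharacter_det_ofInfinite_expGL`, integral `a`-sums) — the general case is the same computation
  ending in `hasArchParameter_glOne_of_eq_smul_one`; 4: its own `Theorems/HalfIntegralTwistCM/Negative/`
  (five files: (ii), (iii), (iv) and `IsCMField` load-bearing by UNCONDITIONAL Lean witnesses over
  `ℚ(ζ₃)`, `ℚ(ζ₅)`; `hypotheses_satisfiable`); 5: `CuspidalAutomorphicRepData.twist` (AutomorphicTwistBJ) +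
  `eventually_hasSatakeParamAt_of_map_mulChar_detTwist` + `HasArchParameter.of_map_mulChar_detTwist` (real
  powers only — the general archimedean differential is the one missing piece; CONVENTION CHECKED: the stub's
  shift `(P ι).map (· + p ι)` agrees in sign with that lemma's `(χ₀ σ).map (· + s)` for `χ = |·|_𝔸^s`, whose
  `GL(1)` datum has parameter `p = q = s` at every embedding by `archParam_complexPlace_glOne` /
  `archParam_realPlace_glOne` — no sign slip between stubs 3, 4, 5).
* **F18 (mutations of the new stubs, on paper).** 1a: the non-dihedral clause, cuspidality of `π` and of
  `σ₀` are each unnecessary for TRUTH (clause-free version true; F10a/b), the a.e. identity is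
  load-bearing, "∀ K" with real places true but unused (the call site has `K` CM). 1b: cuspidality of `π`
  load-bearing (the Eisenstein datum `νε ⊞ ν·AI(ψ)` satisfies R — ALL of `π`'s cuspidality in this line
  now lives in 1b); `finrank K L = 2` load-bearing only to make `ε` non-trivial (`L = K`: `quadraticSign ≡ 1`,
  the self-twist holds for every `σ₀`, and 1b would deny R for every `σ₀` — false on paper by
  `π = Ad(σ₀) ⊗ ν`, unconstructible). 3/5: `NeZero n` harmless; "∀ v" in 5 would be FALSE (ramified `χ`),
  `∀ᶠ` correctly placed; "ω unitary / algebraic" in 3 would be FALSE (`|det|^s`) — not asked.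
* **F19 (why no kernel-checked kill and no "modulo H" lemma this cycle).** Every `_false_without_` /
  `not_…` paper theorem of §§2–6 needs cuspidal `GL₂/GL₃` data with certified parameters (F1). The sibling
  disprover of `HalfIntegralTwistCM` could land UNCONDITIONAL `halfIntegralTwistCM_false_without_*` because
  that item is `GL(1)`-only (Hecke-character data ARE constructible; Weil's criterion enters as the named
  fact `Patrikis2019_heckeCharacter_archType_iff_units`). Transplanting the pattern here as
  `H → ¬ RegularTwistCMWithout…` needs `H ⊇` {the witnessing `σ₀`/`π` with `HasArchParameter` certificates,
  twist-SMO∞ for `σ₀`}; the kernel-checked residue would be exactly the already-landed shadows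
  (`archShadow_mixedParity_obstructed`, `maassType_noAlgebraicTwist`, `cmParity_obstructed`,
  `noGlobalExponent_of_maassType`) in the GL(1) dictionary — recorded as the upgrade path, not pursued
  (no verdict changes: the crux itself is TRUE on paper).
* **F20 (literature, cycle 4).** `lit search` (searchd) rc 75 again — fourth consecutive cycle,
  search-degraded, nothing graded on it; galaxy substring probes add nothing ("paritious": noise only);
  `ledger negatives --problem Langlands`: 1 unrelated entry, unchanged. Verdict after four cycles:
  RESISTS; 0 kills; Targets 6 (reshaped line), broken 0.

## Targets
`payload.targets` / `stuck_stubs` empty at cycles 1–4. Cycle 3: three checked skeletons under `Lines/`, all 17 stubs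
pre-assessed in §6 (F12). Cycle 4: `PICKED.md` = `petersson-hermitian-purity`; the lead's reshaped skeleton fc20f4a48ad5
(six stubs, `-- Targets` of §7) — all survive (F16–F18; drefute concurs); the lead is at cycle 0, nothing stuck yet.
Kill templates for future stuck stubs: §4–§6 (forgetting the `U²`-passage, assuming `Σ_w` place-independent, asking an
algebraic / global-power `χ`, stating a mirror/purity symmetry for NON-cuspidal data) and §7 (`adjointShape_*` pin the
exact multiset any vendored GJ∞ clause must output; `sumPairing_of_centralCharacterDatum` tests any re-typed
central-character stub; `exists_hasInfinityType_of_conjugate_eq` shows a proof of stub 2 must be a complex-place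
pairing argument and nothing else).

Prose lives only in docstrings; §4, §5 (except `not_RegularTwistCMGlobalPowerTwist`), §6 (except
`not_RegularTwistCMAutomorphicBoth`) and §7 are sorry-free; the remaining `sorry`s are paper theorems whose witnesses are
not constructible in the tree (F1), kept here as the record "any proof must use H".

LANDED (importable): §7 as `Summits/Langlands/Langlands/Theorems/RegularTwistCM/Negative/AdjointShapeCertificates.lean`
(namespace `Summit.Langlands.Langlands.Theorems.RegularTwistCM.Negative`, cycle 4, `--supports` stmt-Langlands-14069:
p79135 was bounced only by the 04:32Z gate restart and resubmitted verbatim as p79407 — verdict pending at publication);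
§6's sorry-free lemmas as `Summits/Langlands/Langlands/Theorems/RegularTwistCM/Negative/MirrorCuspidality.lean`
(proposal p76103 ACCEPTED 2026-08-16, commit 8269223d858a, cycle 3, `--supports` stmt-Langlands-14069) and the positive `n = 1`
base case of `UnitaryMirror` as `…/Theorems/RegularTwistCM/Negative/UnitaryMirrorGLOne.lean` (p77023 ACCEPTED, commit 0f8d4d687b0c);
§5's sorry-free lemmas as `Summits/Langlands/Langlands/Theorems/RegularTwistCM/Negative/ArchShadowParity.lean`
(same namespace, proposal p73631 ACCEPTED 2026-08-16, commit 1cdf839f868b, `--supports` stmt-Langlands-14069; it imports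
ArchShadow); §4 verbatim as `Summits/Langlands/Langlands/Theorems/RegularTwistCM/Negative/ArchShadow.lean`
(namespace `Summit.Langlands.Langlands.Theorems.RegularTwistCM.Negative`, proposal p72822, `--supports`
stmt-Langlands-14069) — ideators / planners / the lead may `import` it instead of this workfile.
-/

set_option linter.dupNamespace false

namespace Summit.Langlands.Langlands.Cruxes.RegularTwistCM.Disproof

open Literature.NumberTheory.Automorphic
open scoped BigOperators

/-! ## §1 The crux, by name -/

/-- The crux under attack, by name (definitionally the route decl). [folklore] -/
abbrev Crux : Prop := Summit.Langlands.Langlands.Theses.IrreducibilityBySelfDuality.RegularTwistCM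

/-! ## §2 Load-bearing analysis: the crux with one hypothesis dropped

Each `…Without…` def is the route decl copied verbatim with exactly one hypothesis removed. The
`_false_without_` theorems are PAPER theorems: their witnesses are genuine cuspidal automorphic
representations, not constructible in this tree (finding F1), hence `sorry` — permitted in this
workfile only. The sorry-free content backing each of them is the archimedean shadow in §4. -/

/-- `RegularTwistCM` with the hypothesis `NumberField.IsCMField K` DROPPED (any number field `K`).
FALSE on paper: `K = ℚ(√2)`, `σ₀` a non-CM Hilbert newform of weights `(2,3)` (mixed parity; exists by
Patrikis arXiv:1207.6724, Lemma p. 32), `π := Ad(σ₀)` (Gelbart–Jacquet; RA cuspidal on `GL₃`: at the real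
place of weight `k` the parameter of `Ad(D_k)` on `ℂ^×` is `{k-1, 0, 1-k}`), `ν := 1`. A twist `σ₀ ⊗ χ`,
`χ_{w_i} = |·|^{u_i} sgn^{ε_i}`, is C-algebraic iff `(k_i-1)/2 + u_i ∈ 1/2 + ℤ` iff `u_i ∈ k_i/2 + ℤ`
(`realPlace_twist_exponent`), and `χ` exists iff `χ_∞` is trivial on a finite-index subgroup of
`𝓞^× = ±(1+√2)^ℤ`, i.e. on some `(3+2√2)^{Nℤ}`, which forces `u₁ = u₂` (`parallel_of_unit_condition`)
— incompatible with `u₁ ∈ ℤ`, `u₂ ∈ 1/2 + ℤ` (`archShadow_mixedParity_obstructed`). Also false for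
totally imaginary non-CM `K` (Patrikis Lemma 2.1.5, Remark 1.3.2). [cite: Patrikis2019, Prop. 1.3.3 and Lemma p. 32] -/
def RegularTwistCMWithoutIsCMField : Prop :=
  ∀ (K : Type) [Field K] [NumberField K]
    (h1 : Literature.NumberTheory.Automorphic.isCompact_glFiniteIntegralLevel 1 K)
    (hcpt₂ : Literature.NumberTheory.Automorphic.isCompact_glFiniteIntegralLevel 2 K)
    (hcpt : Literature.NumberTheory.Automorphic.isCompact_glFiniteIntegralLevel 3 K)
    (π : Literature.NumberTheory.Automorphic.CuspidalAutomorphicRepData 3 K hcpt)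
    (σ₀ : Literature.NumberTheory.Automorphic.CuspidalAutomorphicRepData 2 K hcpt₂)
    (ν : Literature.NumberTheory.Automorphic.CuspidalAutomorphicRepData 1 K h1),
    π.1.IsRegularAlgebraic →
    (∀ᶠ v in Filter.cofinite, ∀ α β : Multiset ℂ, π.1.HasSatakeParamAt v α →
      σ₀.1.HasSatakeParamAt v β → ∃ d : ℂ, ν.1.HasSatakeParamAt v {d} ∧
        α = (((β ×ˢ β).map (fun p : ℂ × ℂ => p.1 * p.2⁻¹)).erase 1).map (fun c => d * c)) →
    ∃ (σ : Literature.NumberTheory.Automorphic.CuspidalAutomorphicRepData 2 K hcpt₂)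
      (χ : Literature.NumberTheory.Automorphic.CuspidalAutomorphicRepData 1 K h1),
      σ.1.IsRegularAlgebraic ∧ ∀ᶠ v in Filter.cofinite, ∀ β : Multiset ℂ,
        σ₀.1.HasSatakeParamAt v β → ∃ c : ℂ, χ.1.HasSatakeParamAt v {c} ∧
          σ.1.HasSatakeParamAt v (β.map (fun b => c * b))

/-- Sanity: the crux is exactly the CM restriction of the field-uniform variant. [folklore] -/
theorem crux_of_withoutIsCMField (h : RegularTwistCMWithoutIsCMField) : Crux := by
  intro K _ _ _ h1 hcpt₂ hcpt π σ₀ ν hRA hAd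
  exact h K h1 hcpt₂ hcpt π σ₀ ν hRA hAd

/-- PAPER THEOREM (near-miss, witnesses unconstructible — finding F1): any proof of the crux must use
`IsCMField`. Witness: weights-`(2,3)` Hilbert newform over `ℚ(√2)` (docstring of
`RegularTwistCMWithoutIsCMField`); its archimedean shadow is the sorry-free
`archShadow_mixedParity_obstructed` below. Obstruction to closing it here: no `CuspidalAutomorphicRepData 2 ℚ(√2) _`
with a certified `HasArchParameter` exists in the tree, nor Gelbart–Jacquet at `∞`. [cite: Patrikis2019, Prop. 1.3.3] -/
theorem regularTwistCM_false_without_IsCMField : ¬ RegularTwistCMWithoutIsCMField := by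
  sorry

/-- `RegularTwistCM` with the hypothesis `π.1.IsRegularAlgebraic` DROPPED. FALSE on paper: `K`
imaginary quadratic, `σ₀` cuspidal on `GL₂(𝔸_K)` non-dihedral with `σ₀,w = PS(|z|_ℂ^{ir}, |z|_ℂ^{-ir})`,
`r ∈ ℝ∖{0}` (Maass type; exist in abundance, Weyl law), `π := Ad(σ₀)` (cuspidal, NOT regular algebraic),
`ν := 1`: the hypotheses hold, but a twist by `χ_w = z^u z̄^v` has `a`-exponents `{u + ir, u - ir}`, both in
`1/2 + ℤ` only if `2ir ∈ ℤ`, i.e. `r = 0` (`maassType_noAlgebraicTwist`). The same witness kills the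
variant with the adjoint identity dropped. Regularity proper is needed too: `a_w = 0` (`k₁ = k₂`,
`y₁ = y₂`) admits C-algebraic but no REGULAR twist. [cite: Clozel1990, Déf. 1.8, 3.12] -/
def RegularTwistCMWithoutRegularAlgebraic : Prop :=
  ∀ (K : Type) [Field K] [NumberField K], NumberField.IsCMField K →
    ∀ (h1 : Literature.NumberTheory.Automorphic.isCompact_glFiniteIntegralLevel 1 K)
    (hcpt₂ : Literature.NumberTheory.Automorphic.isCompact_glFiniteIntegralLevel 2 K)
    (hcpt : Literature.NumberTheory.Automorphic.isCompact_glFiniteIntegralLevel 3 K)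
    (π : Literature.NumberTheory.Automorphic.CuspidalAutomorphicRepData 3 K hcpt)
    (σ₀ : Literature.NumberTheory.Automorphic.CuspidalAutomorphicRepData 2 K hcpt₂)
    (ν : Literature.NumberTheory.Automorphic.CuspidalAutomorphicRepData 1 K h1),
    (∀ᶠ v in Filter.cofinite, ∀ α β : Multiset ℂ, π.1.HasSatakeParamAt v α →
      σ₀.1.HasSatakeParamAt v β → ∃ d : ℂ, ν.1.HasSatakeParamAt v {d} ∧
        α = (((β ×ˢ β).map (fun p : ℂ × ℂ => p.1 * p.2⁻¹)).erase 1).map (fun c => d * c)) →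
    ∃ (σ : Literature.NumberTheory.Automorphic.CuspidalAutomorphicRepData 2 K hcpt₂)
      (χ : Literature.NumberTheory.Automorphic.CuspidalAutomorphicRepData 1 K h1),
      σ.1.IsRegularAlgebraic ∧ ∀ᶠ v in Filter.cofinite, ∀ β : Multiset ℂ,
        σ₀.1.HasSatakeParamAt v β → ∃ c : ℂ, χ.1.HasSatakeParamAt v {c} ∧
          σ.1.HasSatakeParamAt v (β.map (fun b => c * b))

/-- Sanity: the variant without regularity implies the crux (the hypothesis is simply unused). [folklore] -/
theorem crux_of_withoutRegularAlgebraic (h : RegularTwistCMWithoutRegularAlgebraic) : Crux := by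
  intro K _ _ hCM h1 hcpt₂ hcpt π σ₀ ν _hRA hAd
  exact h K hCM h1 hcpt₂ hcpt π σ₀ ν hAd

/-- PAPER THEOREM (near-miss, F1): any proof must use `π.1.IsRegularAlgebraic`. Witness: Maass-type `σ₀`
over an imaginary quadratic field (docstring above); shadow `maassType_noAlgebraicTwist`. Obstruction to
closing it here: no cuspidal `GL₂` datum of Maass type is constructible. [cite: Clozel1990, Déf. 1.8, 3.12] -/
theorem regularTwistCM_false_without_RegularAlgebraic : ¬ RegularTwistCMWithoutRegularAlgebraic := by
  sorry

/-! ## §3 Natural strengthenings, refuted on paper -/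

/-- STRENGTHENING: the twisting character `χ` is moreover regular algebraic (type `A₀`). FALSE on paper:
`σ₀ := σ_alg ⊗ |det|^{iy}` with `σ_alg` RA cuspidal non-dihedral on `GL₂` over CM `K` and `y ∈ ℝ∖{0}`;
then `π := Ad(σ_alg)` and `ν := 1` satisfy the hypotheses (Ad is blind to twists), while every RA twist of
`σ₀` is by `χ = |·|^{-iy} · χ_alg`, never algebraic; equally false with "unitary" or "finite order" in place
of "algebraic" (take `σ₀ := σ_alg ⊗ |det|^{1/3}`). Route item RegularAdjointLiftCM rightly asks algebraicity
of `ν` only, never of `χ`. [cite: Weil1956, type (A₀) characters] -/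
def RegularTwistCMAlgebraicTwist : Prop :=
  ∀ (K : Type) [Field K] [NumberField K], NumberField.IsCMField K →
    ∀ (h1 : Literature.NumberTheory.Automorphic.isCompact_glFiniteIntegralLevel 1 K)
    (hcpt₂ : Literature.NumberTheory.Automorphic.isCompact_glFiniteIntegralLevel 2 K)
    (hcpt : Literature.NumberTheory.Automorphic.isCompact_glFiniteIntegralLevel 3 K)
    (π : Literature.NumberTheory.Automorphic.CuspidalAutomorphicRepData 3 K hcpt)
    (σ₀ : Literature.NumberTheory.Automorphic.CuspidalAutomorphicRepData 2 K hcpt₂)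
    (ν : Literature.NumberTheory.Automorphic.CuspidalAutomorphicRepData 1 K h1),
    π.1.IsRegularAlgebraic →
    (∀ᶠ v in Filter.cofinite, ∀ α β : Multiset ℂ, π.1.HasSatakeParamAt v α →
      σ₀.1.HasSatakeParamAt v β → ∃ d : ℂ, ν.1.HasSatakeParamAt v {d} ∧
        α = (((β ×ˢ β).map (fun p : ℂ × ℂ => p.1 * p.2⁻¹)).erase 1).map (fun c => d * c)) →
    ∃ (σ : Literature.NumberTheory.Automorphic.CuspidalAutomorphicRepData 2 K hcpt₂)
      (χ : Literature.NumberTheory.Automorphic.CuspidalAutomorphicRepData 1 K h1),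
      σ.1.IsRegularAlgebraic ∧ χ.1.IsRegularAlgebraic ∧ ∀ᶠ v in Filter.cofinite, ∀ β : Multiset ℂ,
        σ₀.1.HasSatakeParamAt v β → ∃ c : ℂ, χ.1.HasSatakeParamAt v {c} ∧
          σ.1.HasSatakeParamAt v (β.map (fun b => c * b))

/-- The strengthening implies the crux (forget `χ` algebraic). [folklore] -/
theorem crux_of_algebraicTwist (h : RegularTwistCMAlgebraicTwist) : Crux := by
  intro K _ _ hCM h1 hcpt₂ hcpt π σ₀ ν hRA hAd
  obtain ⟨σ, χ, hσ, -, hχ⟩ := h K hCM h1 hcpt₂ hcpt π σ₀ ν hRA hAd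
  exact ⟨σ, χ, hσ, hχ⟩

/-- PAPER THEOREM (near-miss, F1): the algebraic-twist strengthening is false (witness in the docstring of
`RegularTwistCMAlgebraicTwist`; shadow: `imaginaryTwist_notAlgebraic`). [cite: Weil1956, type (A₀) characters] -/
theorem not_RegularTwistCMAlgebraicTwist : ¬ RegularTwistCMAlgebraicTwist := by
  sorry

/-! ## §4 The archimedean shadow — sorry-free

Exponent bookkeeping behind F2–F4. Conventions (checked against `HarishChandraGL`/`ArchimedeanGLn`/
`InfinityType`): a principal series of `GL₂(ℂ)` normally induced from `z^{s₁} z̄^{t₁} ⊗ z^{s₂} z̄^{t₂}` has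
parameter `{s₁, s₂}` on the `id`-copy and `{t₁, t₂}` on the `conj`-copy; C-algebraic for `GL₂` means all
four in `1/2 + ℤ`; a character `z^u z̄^v` of `ℂ^×` needs `u - v ∈ ℤ` and takes the value `r^{u+v}` at
`r ∈ ℝ_{>0}`; at a real place the discrete series `D_k` has parameter `{(k-1)/2, -(k-1)/2}` and a twist by
`|·|^u sgn^ε` shifts it by `u`. -/

/-- LOCAL PARITY FREEDOM AT A COMPLEX PLACE (the CM lever, local half). For exponents `s₁ t₁ : ℂ` with
`s₁ - t₁ ∈ ℤ` (a character of `ℂ^×`) and `a : ℤ` (so `s₂ = s₁ - a`, `t₂ = t₁ + a` after purity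
`b = -a`), the twist `u = 1/2 - s₁`, `v = 1/2 - t₁` is a character of `ℂ^×` (`u - v ∈ ℤ`) making all four
exponents lie in `1/2 + ℤ`, regular as soon as `a ≠ 0`, with modulus exponent `u + v = 1 - (s₁ + t₁)`
(= `1 - Σ_w/2`). [folklore] -/
theorem complexPlace_twist_exists (s₁ t₁ : ℂ) (a : ℤ) (hst : ∃ m : ℤ, s₁ - t₁ = m) :
    ∃ u v : ℂ, (∃ m : ℤ, u - v = m) ∧
      (∃ k : ℤ, s₁ + u = k + 1 / 2) ∧ (∃ k : ℤ, (s₁ - a) + u = k + 1 / 2) ∧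
      (∃ l : ℤ, t₁ + v = l + 1 / 2) ∧ (∃ l : ℤ, (t₁ + a) + v = l + 1 / 2) ∧
      (a ≠ 0 → s₁ + u ≠ (s₁ - a) + u) ∧ u + v = 1 - (s₁ + t₁) := by
  obtain ⟨m, hm⟩ := hst
  refine ⟨1 / 2 - s₁, 1 / 2 - t₁, ⟨-m, ?_⟩, ⟨0, ?_⟩, ⟨-a, ?_⟩, ⟨0, ?_⟩, ⟨a, ?_⟩, ?_, ?_⟩
  · push_cast; linear_combination -hm
  · push_cast; ring
  · push_cast; ring
  · push_cast; ring
  · ring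
  · intro ha h
    apply ha
    have : (a : ℂ) = 0 := by linear_combination h
    exact_mod_cast this
  · ring

/-- BOTH PARITIES ARE AVAILABLE AT A COMPLEX PLACE (why the `ρ`-shift hazard is moot over CM, F4): the
same data also admit a twist making all exponents INTEGRAL (L-algebraic), `u = -s₁`, `v = -t₁`. [folklore] -/
theorem complexPlace_twist_exists_integral (s₁ t₁ : ℂ) (a : ℤ) (hst : ∃ m : ℤ, s₁ - t₁ = m) :
    ∃ u v : ℂ, (∃ m : ℤ, u - v = m) ∧
      (∃ k : ℤ, s₁ + u = k) ∧ (∃ k : ℤ, (s₁ - a) + u = k) ∧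
      (∃ l : ℤ, t₁ + v = l) ∧ (∃ l : ℤ, (t₁ + a) + v = l) := by
  obtain ⟨m, hm⟩ := hst
  refine ⟨-s₁, -t₁, ⟨-m, ?_⟩, ⟨0, ?_⟩, ⟨-a, ?_⟩, ⟨0, ?_⟩, ⟨a, ?_⟩⟩
  · push_cast; linear_combination -hm
  · simp
  · push_cast; ring
  · simp
  · ring

/-- NO PARITY FREEDOM AT A REAL PLACE (shadow of F3, `IsCMField` load-bearing): twisting the weight-`k`
discrete series parameter `{(k-1)/2, -(k-1)/2}` by `|·|^u` lands in `1/2 + ℤ` only for `u ∈ k/2 + ℤ` —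
the parity of `k` is imprinted on the modulus exponent. [cite: Patrikis2019, Prop. 1.3.3] -/
theorem realPlace_twist_exponent (k : ℤ) (u : ℝ) (h : ∃ m : ℤ, ((k : ℝ) - 1) / 2 + u = 1 / 2 + m) :
    ∃ m : ℤ, u = (k : ℝ) / 2 + m := by
  obtain ⟨m, hm⟩ := h
  exact ⟨m + 1 - k, by push_cast; linarith⟩

/-- MIXED PARITY ⇒ NON-PARALLEL MODULUS EXPONENTS: weights `k₁ = 2`, `k₂ = 3` force `u₁ ∈ ℤ`,
`u₂ ∈ 1/2 + ℤ`, hence `u₁ ≠ u₂`. [cite: Patrikis2019, Prop. 1.3.3] -/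
theorem mixedParity_exponents_ne (u₁ u₂ : ℝ) (h₁ : ∃ m : ℤ, u₁ = ((2 : ℤ) : ℝ) / 2 + m)
    (h₂ : ∃ m : ℤ, u₂ = ((3 : ℤ) : ℝ) / 2 + m) : u₁ ≠ u₂ := by
  obtain ⟨m₁, hm₁⟩ := h₁
  obtain ⟨m₂, hm₂⟩ := h₂
  intro h
  have h' : ((2 * m₁ - 2 * m₂ : ℤ) : ℝ) = 1 := by push_cast; push_cast at hm₁ hm₂; linarith
  have h'' : (2 * m₁ - 2 * m₂ : ℤ) = 1 := by exact_mod_cast h'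
  omega

/-- WEIL'S UNIT CONDITION OVER A REAL QUADRATIC FIELD FORCES PARALLEL MODULUS EXPONENTS (shadow of the
`IsCMField` bullet of F3): if `x > 0`, `x ≠ 1` is a totally positive unit (with conjugate `x⁻¹`) and the
archimedean character `|·|_{w₁}^{u₁} |·|_{w₂}^{u₂}` is trivial on it, then `u₁ = u₂`. [cite: Weil1956, unit criterion; Patrikis2019 Lemma 2.1.1] -/
theorem parallel_of_unit_condition {x : ℝ} (hx : 0 < x) (hx1 : x ≠ 1) (u₁ u₂ : ℝ)
    (h : x ^ u₁ * x⁻¹ ^ u₂ = 1) : u₁ = u₂ := by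
  have hlog : Real.log (x ^ u₁ * x⁻¹ ^ u₂) = 0 := by rw [h, Real.log_one]
  have hx' : 0 < x⁻¹ := inv_pos.mpr hx
  rw [Real.log_mul (Real.rpow_pos_of_pos hx _).ne' (Real.rpow_pos_of_pos hx' _).ne',
    Real.log_rpow hx, Real.log_rpow hx', Real.log_inv] at hlog
  have hlogx : Real.log x ≠ 0 := Real.log_ne_zero_of_pos_of_ne_one hx hx1
  have : (u₁ - u₂) * Real.log x = 0 := by linear_combination hlog
  rcases mul_eq_zero.mp this with h0 | h0
  · linarith
  · exact absurd h0 hlogx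

/-- The same on a FINITE-INDEX subgroup (Weil's criterion only asks triviality on some `x^{Nℤ}`, `N ≥ 1`):
`(x^{u₁} x^{-u₂})^N = 1` with a positive base still forces `u₁ = u₂`. [cite: Weil1956, unit criterion] -/
theorem parallel_of_unit_condition_finiteIndex {x : ℝ} (hx : 0 < x) (hx1 : x ≠ 1) (u₁ u₂ : ℝ)
    {N : ℕ} (hN : N ≠ 0) (h : (x ^ u₁ * x⁻¹ ^ u₂) ^ N = 1) : u₁ = u₂ := by
  have hpos : 0 ≤ x ^ u₁ * x⁻¹ ^ u₂ :=
    mul_nonneg (Real.rpow_nonneg hx.le _) (Real.rpow_nonneg (inv_pos.mpr hx).le _)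
  exact parallel_of_unit_condition hx hx1 u₁ u₂ ((pow_eq_one_iff_of_nonneg hpos hN).mp h)

/-- `3 + 2√2 = (1 + √2)²` is a totally positive unit of `ℚ(√2)` with conjugate `3 - 2√2 = (3 + 2√2)⁻¹`.
[folklore] -/
theorem sqrt2_unit_inv : (3 - 2 * Real.sqrt 2 : ℝ) = (3 + 2 * Real.sqrt 2)⁻¹ := by
  have h2 : Real.sqrt 2 * Real.sqrt 2 = 2 := Real.mul_self_sqrt (by norm_num)
  have hpos : (3 + 2 * Real.sqrt 2 : ℝ) ≠ 0 := by positivity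
  field_simp
  linear_combination (-4 : ℝ) * h2

/-- THE ARCHIMEDEAN SHADOW OF `RegularTwistCM` WITHOUT `IsCMField` IS OBSTRUCTED (sorry-free core of
`regularTwistCM_false_without_IsCMField`): over `F = ℚ(√2)` with `σ₀` of weights `(k₁, k₂) = (2, 3)`,
there are NO modulus exponents `(u₁, u₂)` of a twisting character that are (i) C-algebraic at both real
places (`(k_i - 1)/2 + u_i ∈ 1/2 + ℤ`) and (ii) trivial on a finite-index subgroup `(3+2√2)^{Nℤ}` of the
totally positive units (Weil's necessary condition for `χ` to exist). [cite: Patrikis2019, Prop. 1.3.3 and Lemma p. 32] -/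
theorem archShadow_mixedParity_obstructed :
    ¬ ∃ u₁ u₂ : ℝ, (∃ m : ℤ, (((2 : ℤ) : ℝ) - 1) / 2 + u₁ = 1 / 2 + m) ∧
        (∃ m : ℤ, (((3 : ℤ) : ℝ) - 1) / 2 + u₂ = 1 / 2 + m) ∧
        ∃ N : ℕ, N ≠ 0 ∧
          ((3 + 2 * Real.sqrt 2) ^ u₁ * (3 - 2 * Real.sqrt 2) ^ u₂) ^ N = 1 := by
  rintro ⟨u₁, u₂, h₁, h₂, N, hN, h⟩
  have hx : (0 : ℝ) < 3 + 2 * Real.sqrt 2 := by positivity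
  have hx1 : (3 + 2 * Real.sqrt 2 : ℝ) ≠ 1 := by
    have : (0 : ℝ) ≤ Real.sqrt 2 := Real.sqrt_nonneg 2
    intro h; linarith
  rw [sqrt2_unit_inv] at h
  have hpar := parallel_of_unit_condition_finiteIndex hx hx1 u₁ u₂ hN h
  exact mixedParity_exponents_ne u₁ u₂ (realPlace_twist_exponent 2 u₁ h₁)
    (realPlace_twist_exponent 3 u₂ h₂) hpar

/-- MAASS-TYPE SHADOW (core of `regularTwistCM_false_without_RegularAlgebraic`): exponents `{u + c, u - c}`
(`c = ir`, or any `c` with `2c ∉ ℤ`) are never both in `1/2 + ℤ`; contrapositively, both in `1/2 + ℤ`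
forces `2c ∈ ℤ`. [cite: Clozel1990, Déf. 1.8] -/
theorem maassType_noAlgebraicTwist (u c : ℂ) (h₁ : ∃ k : ℤ, u + c = k + 1 / 2)
    (h₂ : ∃ k : ℤ, u - c = k + 1 / 2) : ∃ m : ℤ, 2 * c = m := by
  obtain ⟨k₁, hk₁⟩ := h₁
  obtain ⟨k₂, hk₂⟩ := h₂
  exact ⟨k₁ - k₂, by push_cast; linear_combination hk₁ - hk₂⟩

/-- In particular for `c = i r` with `r` real, algebraic twistability forces `r = 0` (no Maass type).
[cite: Clozel1990, Déf. 1.8] -/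
theorem maassType_noAlgebraicTwist_real (u : ℂ) (r : ℝ)
    (h₁ : ∃ k : ℤ, u + Complex.I * r = k + 1 / 2) (h₂ : ∃ k : ℤ, u - Complex.I * r = k + 1 / 2) :
    r = 0 := by
  obtain ⟨m, hm⟩ := maassType_noAlgebraicTwist u (Complex.I * r) h₁ h₂
  have him := congrArg Complex.im hm
  simp at him
  linarith

/-- IMAGINARY-TWIST SHADOW (core of `not_RegularTwistCMAlgebraicTwist`): if `s` is C-algebraic
(`s ∈ 1/2 + ℤ`) and `s + iy + u` is again in `1/2 + ℤ` with `u` ALGEBRAIC (`u ∈ ℤ` or `1/2 + ℤ`, i.e.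
`2u ∈ ℤ`), then `y = 0`: undoing `|det|^{iy}` needs a non-algebraic `χ`. [cite: Weil1956, type (A₀) characters] -/
theorem imaginaryTwist_notAlgebraic (s u : ℂ) (y : ℝ) (hs : ∃ k : ℤ, s = k + 1 / 2)
    (hu : ∃ m : ℤ, 2 * u = m) (h : ∃ k : ℤ, s + Complex.I * y + u = k + 1 / 2) : y = 0 := by
  obtain ⟨k, hk⟩ := hs
  obtain ⟨m, hm⟩ := hu
  obtain ⟨k', hk'⟩ := h
  have him := congrArg Complex.im hk'
  have hmu : u.im = 0 := by
    have := congrArg Complex.im hm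
    simpa using this
  have hsi : s.im = 0 := by
    have := congrArg Complex.im hk
    simpa using this
  simp [hmu, hsi] at him
  exact him

/-- THE SQUARES TRICK (F2, second correction): if a real-valued additive functional `L` on a lattice `Λ`
(here: `u ↦ Σ_w Im(Σ_w) log u_w` on the totally positive `K⁺`-units where `ω_{σ₀,∞} = 1`) takes values
in `2πℤ`, then `L/2` takes values in `2πℤ` on `2Λ` (the squares `U²`). This is what makes
`χ_∞ = exp(-(1/2)·L)` trivial on a finite-index subgroup WITHOUT `Σ_w` being place-independent. [folklore] -/
theorem squares_trick {Λ : Type*} [AddCommGroup Λ] (L : Λ →+ ℝ)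
    (h : ∀ x, ∃ k : ℤ, L x = 2 * Real.pi * k) (x : Λ) :
    ∃ k : ℤ, L (2 • x) / 2 = 2 * Real.pi * k := by
  obtain ⟨k, hk⟩ := h x
  exact ⟨k, by rw [map_nsmul, hk]; ring⟩

/-- TIGHTNESS of the squares trick: index 2 cannot be dropped in general — `L(Λ) ⊆ 2πℤ` does not give
`(L/2)(Λ) ⊆ 2πℤ` (`Λ = ℤ`, `L x = 2πx`, `x = 1`). So a proof of the crux that checks triviality of `χ_∞`
on `U` itself (rather than on `U²` or another deeper finite-index subgroup) is checking something false
for Maass-type central characters. [folklore] -/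
theorem squares_trick_tight :
    ∃ L : ℤ →+ ℝ, (∀ x, ∃ k : ℤ, L x = 2 * Real.pi * k) ∧ ¬ ∀ x, ∃ k : ℤ, L x / 2 = 2 * Real.pi * k := by
  refine ⟨zmultiplesHom ℝ (2 * Real.pi), fun x => ⟨x, ?_⟩, fun hall => ?_⟩
  · rw [zmultiplesHom_apply, zsmul_eq_mul, mul_comm]
  · obtain ⟨k, hk⟩ := hall 1
    rw [zmultiplesHom_apply, one_zsmul] at hk
    have h1 : Real.pi * (1 - 2 * k) = 0 := by linear_combination hk
    rcases mul_eq_zero.mp h1 with h | h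
    · exact Real.pi_ne_zero h
    · have : (1 : ℝ) = 2 * k := by linarith
      have h2 : (1 : ℤ) = 2 * k := by exact_mod_cast this
      omega

/-- WEIL'S CRITERION, REAL PART (F2): a linear functional `x ↦ Σ_w c_w x_w` vanishing on the trace-zero
hyperplane (spanned by the unit log-lattice of `K⁺`) has all `c_w` equal — this is why `Re Σ_w` (and the
real part of any Hecke character's modulus exponents) is place-independent, while imaginary parts only
satisfy a lattice condition. Stated for the hyperplane itself (the lattice spans it by Dirichlet). [cite: Weil1956, unit criterion] -/
theorem parallel_of_vanishing_on_traceZero {ι : Type*} [Fintype ι] [DecidableEq ι] (c : ι → ℝ)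
    (h : ∀ x : ι → ℝ, ∑ w, x w = 0 → ∑ w, c w * x w = 0) (w₁ w₂ : ι) : c w₁ = c w₂ := by
  by_cases hw : w₁ = w₂
  · rw [hw]
  · have := h (Pi.single w₁ 1 - Pi.single w₂ 1) (by
      simp [Finset.sum_sub_distrib])
    simp [mul_sub, Finset.sum_sub_distrib, Pi.single_apply] at this
    linarith

/-! ## §5 Cycle 2 (refuter-cdisprove-stmt-Langlands-14069-g2-0, 2026-08-16): the exact archimedean
input (CM parity), the literature anchor with page hits, and one more refuted normalisation

**F6 (THIRD CORRECTION — what any proof really consumes at `∞`).** Write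
`σ₀,w = PS(z^{s₁}z̄^{t₁}, z^{s₂}z̄^{t₂})` (an irreducible principal series: `σ₀` cuspidal ⇒ generic ⇒
infinite-dimensional) and `a_w = s₁-s₂`, `b_w = t₁-t₂`; `π` RA + (GJ at `∞`, JS II 4.4) give
`a_w, b_w ∈ ℤ∖{0}`. LOCALLY NOTHING MORE IS NEEDED: for all integers `m, m'` the twist
`χ_w = z^{1/2-s₁+m} z̄^{1/2-t₁+m'}` makes `σ₀,w ⊗ χ_w` regular C-algebraic, whatever the relation between
`a_w` and `b_w` (`complexPlace_twist_exists_free`; cycle 1's `complexPlace_twist_exists` hard-wired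
`b = -a`). GLOBALLY, on the totally positive units `U` of `K⁺` killed by `ω_{σ₀,∞}`,
`χ_∞(u) = exp(-(1/2) Σ_w Σ_w log u_w) · ∏_w u_w^{n_w - (a_w+b_w)/2}` with `n_w = m_w + m'_w`
(last clause of `complexPlace_twist_exists_free`: `u+v = n_w + 1 - Σ_w/2 - (a_w+b_w)/2`). The first factor
is `±1` on `U` and `1` on `U²` (squares trick, §4). The second is trivial on a finite-index subgroup iff
`w ↦ n_w - (a_w+b_w)/2` is CONSTANT (Dirichlet/Weil, `parallel_of_unit_condition_finiteIndex`), which is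
soluble in integers `n_w` iff
  (P)  all `a_w + b_w` have the SAME PARITY  ("CM-paritious"; `cmParity_sufficient`),
and is insoluble for mixed parity over a quartic CM field (`cmParity_obstructed`: `K⁺ = ℚ(√2)`, unit
`3+2√2`; no integer shifts rescue it). So (P) is the precise archimedean input. For CUSPIDAL `σ₀` it holds
in the strong form `a_w + b_w = 0`, by LOCAL unitarity up to `|det|_w^{s'}` (complementary series are
excluded by `a_w ∈ ℤ`; unitary principal series have `b_w = -a_w`) — the only use of the cuspidality of
`σ₀` at `∞` besides genericity. Neither Clozel purity of `π` nor place-independence of `Re Σ_w` is used.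
Consequences for provers: over an IMAGINARY QUADRATIC `K` (one complex place, unit rank `0`,
`unitCondition_trivial_of_finite`) there is no unit condition at all — the first case with content is
`[K:ℚ] = 4`; and a skeleton that only extracts "irreducible principal series with `a_w, b_w ∈ ℤ`" from
the hypotheses CANNOT be completed over a quartic CM field without ALSO importing local unitarity (or any
input giving (P)). (P) is implied by `b_w = ±a_w` at each place SEPARATELY — the SIGN is irrelevant
(`a_w + b_w ∈ {0, 2a_w}` is even either way) — so, for the crux ideas on file at 2026-08-16T01:13Z
(`ledger crux ideas stmt-Langlands-14069`): the outputs of `multiset-purity-parity` (`b = a ∨ b = -a`),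
`petersson-hermitian-purity` / `unitary-mirror-parity` (Hermitian mirror `HC(τ̄) = -conj HC(τ) + 2r`,
hence `b = ∓a`) each SUFFICE as the parity input, whereas the transfer `C⁺` of `gamma-divisor-rigidity`
ALONE (`a_w, b_w ∈ ℤ∖{0}`, parity invisible to the Gamma divisor, as that card concedes) does NOT suffice
over a quartic CM field — `cmParity_obstructed` is the two-place witness `(a,b) = (2,-1)` at `w₁`,
`(1,-1)` at `w₂` (both irreducible generic principal series: reducibility needs `a_w b_w > 0`).
Cross-reference (ledger, 2026-08-16T01:21Z): the planner's typed split files the GL(1) lever as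
`HalfIntegralTwistCM` (stmt-Langlands-14036, rank 4), whose hypothesis (iii)
"`(s₁-s₂)(ι) + (s₁-s₂)(ῑ) ∈ 2ℤ`" IS (P) in the even form — `cmParity_obstructed` is the formal witness
that (iii) is load-bearing there (drop it and the real-quadratic-`K⁺` unit kills the conclusion), and
(iii) could harmlessly be relaxed to "constant parity in `w`" (all odd also globalises:
`∏_w u_w^{-c/2} = N(u)^{-c/2} = 1`). Whatever feeds (iii) — local unitarity of cuspidal `σ₀,w`, the
Hermitian mirror, or Clozel's multiset purity of `π` (`{b,0,-b} = {-a,0,a}` ⇒ `b = ±a`) — is the one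
archimedean input of the crux beyond integrality/regularity.

**F7 (literature anchor; pages READ this cycle in arXiv:1207.6724 = S. Patrikis, *Variations on a theorem
of Tate*, Mem. AMS 258 (2019), no. 1238).** On paper the crux IS Patrikis's Prop. 1.3.1(1) of the part
"Lifting W-algebraic representations" (arXiv p. 46–47: `F` CM, `π` cuspidal on `G = SL₂`, `π_∞` tempered,
`π` L-algebraic ⇒ an L-algebraic lift `π̃` to `G̃ = GL₂` exists) applied to a constituent `π⁰ ⊂ σ₀|_{SL₂(𝔸)}`
(L-algebraic and regular because `a_w ∈ ℤ∖{0}`, tempered at `∞` by F6), followed by Labesse–Langlands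
(`π̃ ≅ σ₀ ⊗ χ`) and `⊗ |det|^{1/2}`; its engine is Def. 1.1.1 (p. 43: the type-`A` extension `ω̃` of the
central character, which exists over CM by Lemma 2.1.5(3), p. 19: "if `F` is totally real or CM, then
(unitary) type `A` extensions of `ω` always exist") and Cor. 2.1.8(2) (p. 20: Maass-type characters are
"nearly divisible", `χⁿ χ₀ = ψ` with `χ₀` of finite order) — the printed form of the squares trick and of its
finite-order ambiguity `U/U²`. The oldest printed instance of the lever is the Blasius–Rogawski observation
quoted on p. 30: "while a 'mixed parity' Hilbert modular representation `π` does not itself twist to an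
L-algebraic representation, its base changes to every CM field will" (twist by the type-`A`, non-`A₀`
character `ψ_v(z) = (z/|z|)^{k_v-1}`). Failure off CM: Remark 1.3.2 + Lemma 2.1.5(1) (totally imaginary
non-CM), Prop. 1.3.3 (totally real). Nothing in print claims a counterexample or sharpness AGAINST the CM
statement: `lit galaxy search` (bm25 over web PDFs, 12 hits for "GL(2) over CM / mixed parity /
type A not A₀ twist") surfaces only Ramakrishnan's multiplicity one for SL(2), Prasad–Schulze-Pillot,
Langlands surveys — no counter-claim; substring probes "non-paritious", "mixed parity Bianchi" 0 hits;
`lit search` (searchd) was unavailable (rc 75, twice) during this cycle — re-run next cycle (recorded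
in NOTES.md as search-degraded; no grade depends on it).

**F8 (one more tempting normalisation, FALSE on paper).** "First replace `σ₀` by `σ₀ ⊗ |det|^s` for ONE
global `s ∈ ℂ`, then twist by an ALGEBRAIC character", i.e. `χ = |·|_𝔸^s · χ_alg`
(def `RegularTwistCMGlobalPowerTwist`): false as soon as `ω_{σ₀}` has a genuinely Maass-type component
(Patrikis Def. 2.1.7), which needs unit rank `≥ 1`, i.e. `[K:ℚ] ≥ 4`. Witness: `K ⊃ K⁺ = ℚ(√2)` CM quartic,
`λ` a unitary Hecke character of `K` of Maass type with `(t_{w₁}, t_{w₂}) = (t, -t)`,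
`t ∈ (π / (2 log (1+√2))) ℤ ∖ {0}` (exists: Weil's criterion on `𝓞_K^× ⊇ ⟨1+√2⟩` of finite index),
`σ_alg` RA cuspidal non-dihedral on `GL₂(𝔸_K)`, `σ₀ := σ_alg ⊗ λ`, `π := Ad(σ_alg) = Ad(σ₀)`, `ν := 1`:
every RA twist is by `χ = λ⁻¹ · (type A₀)`, whose modulus exponents `-2it_w + ℤ` are not of the form
`2s + ℤ` at both places (`noGlobalExponent_of_maassType`, sorry-free). Cycle 1's F4 covered `s = iy`
(one place); the point here is that NO single `s` works once `t_w` varies with `w`.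
NOT refutable (checked, do not file): "σ can be chosen unitary/tempered at `∞`" is TRUE (take
`n_w = -1` at every place: exponents `(1/2+m, -1/2-m)`), and "L-algebraic instead of C-algebraic" is TRUE
(cycle 1, `complexPlace_twist_exists_integral`). -/

/-- LOCAL TWIST AT A COMPLEX PLACE, PURITY-FREE, WITH THE INTEGER FREEDOM EXPLICIT (F6): for a
principal series `PS(z^{s₁}z̄^{t₁}, z^{s₂}z̄^{t₂})` with `s₁ - t₁ ∈ ℤ`, `s₂ = s₁ - a`, `t₂ = t₁ - b`
(`a, b ∈ ℤ` INDEPENDENT — no purity, no unitarity) and ANY integers `m, m'`, the character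
`χ_w = z^{1/2-s₁+m} z̄^{1/2-t₁+m'}` of `ℂ^×` makes all four exponents lie in `1/2 + ℤ`, regular when
`a ≠ 0`, `b ≠ 0`, with modulus exponent `u + v = (m+m') + 1 - Σ_w/2 - (a+b)/2`,
`Σ_w = s₁+s₂+t₁+t₂`. [folklore] -/
theorem complexPlace_twist_exists_free (s₁ t₁ : ℂ) (a b m m' : ℤ) (hst : ∃ k : ℤ, s₁ - t₁ = k) :
    ∃ u v : ℂ, (∃ k : ℤ, u - v = k) ∧
      (∃ k : ℤ, s₁ + u = k + 1 / 2) ∧ (∃ k : ℤ, (s₁ - a) + u = k + 1 / 2) ∧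
      (∃ l : ℤ, t₁ + v = l + 1 / 2) ∧ (∃ l : ℤ, (t₁ - b) + v = l + 1 / 2) ∧
      (a ≠ 0 → s₁ + u ≠ (s₁ - a) + u) ∧ (b ≠ 0 → t₁ + v ≠ (t₁ - b) + v) ∧
      u + v = ((m + m' : ℤ) : ℂ) + 1 - (s₁ + (s₁ - a) + t₁ + (t₁ - b)) / 2 - ((a : ℂ) + b) / 2 := by
  obtain ⟨k, hk⟩ := hst
  refine ⟨1 / 2 - s₁ + m, 1 / 2 - t₁ + m', ⟨m - m' - k, ?_⟩, ⟨m, ?_⟩, ⟨m - a, ?_⟩, ⟨m', ?_⟩,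
    ⟨m' - b, ?_⟩, ?_, ?_, ?_⟩
  · push_cast; linear_combination -hk
  · ring
  · push_cast; ring
  · ring
  · push_cast; ring
  · intro ha h
    apply ha
    have : (a : ℂ) = 0 := by linear_combination h
    exact_mod_cast this
  · intro hb h
    apply hb
    have : (b : ℂ) = 0 := by linear_combination h
    exact_mod_cast this
  · push_cast; ring

/-- THE CM-PARITY OBSTRUCTION (F6; the CM transplant of Patrikis Prop. 1.3.3): over a quartic CM field
with `K⁺ = ℚ(√2)` (totally positive unit `3+2√2 ↦ (3+2√2, 3-2√2)` at the two complex places), if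
`a₁+b₁` and `a₂+b₂` have DIFFERENT parity then for NO integer shifts `n₁, n₂` and no common real part `c`
is the modulus `∏_w u_w^{c + n_w - (a_w+b_w)/2}` of `χ_∞` trivial on a finite-index subgroup
`(3+2√2)^{Nℤ}` — so no Hecke character `χ` with the locally required exponents exists. For cuspidal `σ₀`
this never bites (`a_w + b_w = 0`), which is exactly the input a proof must import.
[cite: Patrikis2019, Prop. 1.3.3 and Lemma 2.1.5] -/
theorem cmParity_obstructed (c : ℝ) (a₁ b₁ a₂ b₂ : ℤ) (hodd : Odd (a₁ + b₁ - (a₂ + b₂))) :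
    ¬ ∃ n₁ n₂ : ℤ, ∃ N : ℕ, N ≠ 0 ∧
      ((3 + 2 * Real.sqrt 2) ^ (c + n₁ - ((a₁ : ℝ) + b₁) / 2) *
        (3 - 2 * Real.sqrt 2) ^ (c + n₂ - ((a₂ : ℝ) + b₂) / 2)) ^ N = 1 := by
  rintro ⟨n₁, n₂, N, hN, h⟩
  have hx : (0 : ℝ) < 3 + 2 * Real.sqrt 2 := by positivity
  have hx1 : (3 + 2 * Real.sqrt 2 : ℝ) ≠ 1 := by
    have : (0 : ℝ) ≤ Real.sqrt 2 := Real.sqrt_nonneg 2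
    intro h
    linarith
  rw [sqrt2_unit_inv] at h
  have hpar := parallel_of_unit_condition_finiteIndex hx hx1 _ _ hN h
  obtain ⟨r, hr⟩ := hodd
  have h2 : ((a₁ + b₁ - (a₂ + b₂) : ℤ) : ℝ) = ((2 * (n₁ - n₂) : ℤ) : ℝ) := by
    push_cast
    linarith
  have h3 : (a₁ + b₁ - (a₂ + b₂) : ℤ) = 2 * (n₁ - n₂) := by exact_mod_cast h2
  omega

/-- CM-PARITY SUFFICES for the algebraic half of the unit condition (F6, converse): if all `a_w + b_w`
are `≡ c (mod 2)` then integer shifts `n_w` exist making `n_w - (a_w+b_w)/2` place-independent (so that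
`∏_w u_w^{n_w - (a_w+b_w)/2} = N(u)^{const} = 1` on units of norm `1`). [folklore] -/
theorem cmParity_sufficient {ι : Type*} (a b : ι → ℤ) (c : ℤ)
    (h : ∀ w, ∃ r : ℤ, a w + b w = c + 2 * r) :
    ∃ n : ι → ℤ, ∀ w w', (n w : ℝ) - ((a w : ℝ) + b w) / 2 = n w' - ((a w' : ℝ) + b w') / 2 := by
  choose r hr using h
  refine ⟨r, fun w w' => ?_⟩
  have hw : ((a w : ℝ) + b w) = c + 2 * r w := by exact_mod_cast hr w
  have hw' : ((a w' : ℝ) + b w') = c + 2 * r w' := by exact_mod_cast hr w'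
  rw [hw, hw']
  ring

/-- UNIT RANK ZERO (F6): over an imaginary quadratic field the global units form a FINITE group, so
Weil's criterion is automatic — every character of the units is killed on the finite-index subgroup
`{1}`. The crux over imaginary quadratic `K` therefore needs nothing at `∞` beyond the local shape. [folklore] -/
theorem unitCondition_trivial_of_finite {U : Type*} [Group U] [Finite U] (f : U →* ℂˣ) :
    ∃ H : Subgroup U, H.FiniteIndex ∧ ∀ u ∈ H, f u = 1 := by
  refine ⟨⊥, ?_, fun u hu => ?_⟩
  · infer_instance
  · rw [Subgroup.mem_bot] at hu
    simp [hu]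

/-- STRENGTHENING (F8): the twisting character is `|·|_𝔸^s · χ_alg` for ONE `s ∈ ℂ` and a regular
algebraic (type `A₀`) GL(1) datum `χ_alg` — in Satake language `c_v = q_v^{-s} · c'_v` a.e. FALSE on
paper (witness in the §5 docblock: `σ₀ = σ_alg ⊗ λ`, `λ` of Maass type with `t_{w₁} ≠ t_{w₂}` over a
quartic CM field); shadow `noGlobalExponent_of_maassType`. [cite: Patrikis2019, Def. 2.1.7 and Cor. 2.1.8] -/
def RegularTwistCMGlobalPowerTwist : Prop :=
  ∀ (K : Type) [Field K] [NumberField K], NumberField.IsCMField K →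
    ∀ (h1 : Literature.NumberTheory.Automorphic.isCompact_glFiniteIntegralLevel 1 K)
    (hcpt₂ : Literature.NumberTheory.Automorphic.isCompact_glFiniteIntegralLevel 2 K)
    (hcpt : Literature.NumberTheory.Automorphic.isCompact_glFiniteIntegralLevel 3 K)
    (π : Literature.NumberTheory.Automorphic.CuspidalAutomorphicRepData 3 K hcpt)
    (σ₀ : Literature.NumberTheory.Automorphic.CuspidalAutomorphicRepData 2 K hcpt₂)
    (ν : Literature.NumberTheory.Automorphic.CuspidalAutomorphicRepData 1 K h1),
    π.1.IsRegularAlgebraic →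
    (∀ᶠ v in Filter.cofinite, ∀ α β : Multiset ℂ, π.1.HasSatakeParamAt v α →
      σ₀.1.HasSatakeParamAt v β → ∃ d : ℂ, ν.1.HasSatakeParamAt v {d} ∧
        α = (((β ×ˢ β).map (fun p : ℂ × ℂ => p.1 * p.2⁻¹)).erase 1).map (fun c => d * c)) →
    ∃ (σ : Literature.NumberTheory.Automorphic.CuspidalAutomorphicRepData 2 K hcpt₂)
      (χ : Literature.NumberTheory.Automorphic.CuspidalAutomorphicRepData 1 K h1),
      σ.1.IsRegularAlgebraic ∧
      (∃ (s : ℂ) (χ' : Literature.NumberTheory.Automorphic.CuspidalAutomorphicRepData 1 K h1),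
        χ'.1.IsRegularAlgebraic ∧ ∀ᶠ v in Filter.cofinite, ∀ c : ℂ, χ.1.HasSatakeParamAt v {c} →
          ∃ c' : ℂ, χ'.1.HasSatakeParamAt v {c'} ∧ c = ((v.residueCard : ℕ) : ℂ) ^ (-s) * c') ∧
      ∀ᶠ v in Filter.cofinite, ∀ β : Multiset ℂ,
        σ₀.1.HasSatakeParamAt v β → ∃ c : ℂ, χ.1.HasSatakeParamAt v {c} ∧
          σ.1.HasSatakeParamAt v (β.map (fun b => c * b))

/-- The global-power strengthening implies the crux (forget the shape of `χ`). [folklore] -/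
theorem crux_of_globalPowerTwist (h : RegularTwistCMGlobalPowerTwist) : Crux := by
  intro K _ _ hCM h1 hcpt₂ hcpt π σ₀ ν hRA hAd
  obtain ⟨σ, χ, hσ, -, hχ⟩ := h K hCM h1 hcpt₂ hcpt π σ₀ ν hRA hAd
  exact ⟨σ, χ, hσ, hχ⟩

/-- PAPER THEOREM (near-miss, F1): the global-power strengthening is false (witness in the §5 docblock;
shadow `noGlobalExponent_of_maassType`). Obstruction to closing it here: no cuspidal `GL₂` datum and no
Maass-type Hecke character as a `CuspidalAutomorphicRepData 1 K h1` with certified archimedean parameter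
is constructible in the tree. [cite: Patrikis2019, Def. 2.1.7 and Cor. 2.1.8] -/
theorem not_RegularTwistCMGlobalPowerTwist : ¬ RegularTwistCMGlobalPowerTwist := by
  sorry

/-- MAASS-TYPE SHADOW OF F8 (sorry-free core of `not_RegularTwistCMGlobalPowerTwist`): if the modulus
exponents required at two complex places are `c - 2it₁ + ℝ` and `c - 2it₂ + ℝ` (the real summands being
what an algebraic, finite-order or real-power character can contribute) and `t₁ ≠ t₂`, then no single
complex `s` serves both places. [cite: Patrikis2019, Def. 2.1.7 and Cor. 2.1.8] -/
theorem noGlobalExponent_of_maassType (c : ℂ) (t₁ t₂ : ℝ) (ht : t₁ ≠ t₂) :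
    ¬ ∃ (s : ℂ) (r₁ r₂ : ℝ), s + r₁ = c - 2 * Complex.I * t₁ ∧ s + r₂ = c - 2 * Complex.I * t₂ := by
  rintro ⟨s, r₁, r₂, h₁, h₂⟩
  have h : ((r₁ : ℂ) - r₂) = -(2 * Complex.I * t₁) + 2 * Complex.I * t₂ := by
    linear_combination h₁ - h₂
  have him := congrArg Complex.im h
  simp at him
  apply ht
  linarith


/-! ## §6 Cycle 3 (refuter-cdisprove-stmt-Langlands-14069-g3-0, 2026-08-16): cuspidality mutations, the
unitary mirror's tightness, and the seventeen stubs of the three filed lines as Targets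

State at this cycle: three CHECKED skeletons are filed under `Cruxes/RegularTwistCM/Lines/` —
`multiset-purity-parity` (5 stubs), `unimodular-normal-form` (6 stubs), `unitary-mirror-parity` (6 stubs) —
no `PICKED.md`, `payload.targets = stuck_stubs = ∅`. So the Targets of this cycle are ALL seventeen stubs,
pre-assessed before the lead picks (table below), plus two more hypothesis mutations of the crux itself.

**F10 (the two cuspidality hypotheses, mutated one at a time and together).**
(a) `π` merely AUTOMORPHIC (an irreducible Borel–Jacquet subquotient of the space of automorphic forms on
`GL₃`, def `RegularTwistCMAutomorphicPi`): still TRUE on paper — by Langlands' Prop. 2 (Corvallis, "On the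
notion of an automorphic representation") `π` is a constituent of some `Ind(ρ)`, `ρ` cuspidal on a Levi, so
its Satake parameters (a.e.) and its Harish-Chandra parameter are those of `Ind(ρ)`; `t_π = d·Ad(t_{σ₀})`
a.e. and JS II Thm 4.4 identify the cuspidal support with that of `Ad⁰(σ₀) ⊠ ν` (GJ), hence
`HC(π)(ι) = HC(Ad⁰(σ₀,w) ⊗ ν_w)(ι)` EXACTLY AS FOR CUSPIDAL `π` — cuspidality of `π` enters every line only
through this equality (`stub_adjointArchShadow`), never elsewhere. (b) `σ₀` merely automorphic (def
`RegularTwistCMAutomorphicSigma`): still TRUE, the new cases being VACUOUS — a non-cuspidal `σ₀` is a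
constituent of `Ind(χ₁|·|^{s}, χ₂|·|^{-s})`, `Ad(t_{σ₀}) = {μ(ϖ), 1, μ(ϖ)⁻¹}`, `μ = χ₁χ₂⁻¹|·|^{2s}`, the
Satake datum of the isobaric `νμ ⊞ ν ⊞ νμ⁻¹`, which no CUSPIDAL `π` carries a.e. (JS II 4.4). (c) BOTH merely
automorphic (def `RegularTwistCMAutomorphicBoth`): FALSE on paper — `K` any CM field, `μ` a Hecke character
of type `(z/|z|)²` at every complex place (exists over CM: `angular_trivial_on_realSquares`), `σ₀ := μ ⊞ 𝟙`,
`π := μ ⊞ 𝟙 ⊞ μ⁻¹` (regular C-algebraic: `eisensteinWitness_HC_regularIntegral`), `ν := 𝟙`; the conclusion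
asks for a CUSPIDAL `σ` with Eisenstein Satake parameters `c_v{μ(ϖ_v), 1}` — impossible (JS II 4.4). So
the typing "`σ` cuspidal" in the CONCLUSION is what the double mutation breaks; with "`σ` automorphic" there
too it would be true again (`σ := σ₀ ⊗ χ` Eisenstein). Single mutations: "possibly unnecessary" (information
for the prover: nothing in any line needs more of `π` than its HC/Satake data).

**F11 (lever of line `unitary-mirror-parity`: `UnitaryMirror` — cuspidality is load-bearing, temperedness
is not).** Sorry-free: `mirror_offAxis_obstructed` — the parameter `{s, -s}` (at `ι` AND at `ῑ`) of the
spherical Eisenstein datum `|·|_ℂ^{s} ⊞ |·|_ℂ^{-s}` on `GL₂` (automorphic, not cuspidal) has NO mirror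
constant once `Re s ≠ 0`, `Im s ≠ 0`; `mirror_onAxis` — on the axes it does (`c = 0`): tempered Eisenstein
(`Re s = 0`), the trivial representation (`s = 1/2`), complementary series. So `stub_unitaryMirror` must
USE `W ≤ cusp forms` (the card's Petersson-pairing plan does), and the mirror certifies exactly "unitary up
to a real twist". At `n = 1` the mirror is the pairing `p - q ∈ ℤ` and nothing more (`mirror_glOne_iff`,
`mirror_glOne_of_pairing`; cf. the sibling disprover's PROVED `exists_re_archParam_parallel_glOne` in
`Theorems/HalfIntegralTwistCM/Negative/ModulusParallel.lean`, which gives the uniform `c` at `n = 1`).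
POSITIVE BASE CASE (attached as item evidence `UnitaryMirrorGLOne.lean`, proposed to
`Theorems/RegularTwistCM/Negative/UnitaryMirrorGLOne.lean` as p77023 — ACCEPTED, commit 0f8d4d687b0c; axioms standard): `unitaryMirror_one` —
`UnitaryMirror` holds VERBATIM at `n = 1` for ALL automorphic `GL₁` data over any number field, and its proof
is literally pairing (`archParam_embedding_sub_conj_mem_int_glOne`) + parallel real parts
(`exists_re_archParam_parallel_glOne`, the only source of the uniform `c = 2σ`).

**F12 (TARGETS — the seventeen stubs, pre-assessed; none is Lean-refutable, none is mis-stated).**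
Legend: T = true on paper (source) · L = what a Lean proof needs · E = edge instances checked here.
Line `multiset-purity-parity` (namespace `…Cruxes.RegularTwistCM.MultisetPurityParity`):
* `S.stub_adjointArchShadow` — T (GJ 1978 Thm 9.3 at `∞` + JS II 4.4 + Clozel §3.3 for `T₀`); L: XL, no
  tree shadow of GJ at `∞`; E: real places fine (`D_k`: `{x-y,0,y-x} = {k-1,0,1-k}`), dihedral `σ₀` vacuous.
  SHARED in content with `stub_adjointArchShadow` of the other two lines (those take `χσ, χν` as inputs
  instead of producing `T₀, p`; the multiset version additionally BUNDLES `exists_hasInfinityType σ₀`).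
* `S.stub_purity` — T (Clozel Lemme 4.9; `n = 0` admitted and trivially true: card-`0` multisets); L: one
  line from the named fact `Clozel1990_regularAlgebraic` (iii); E: real embeddings (`w = 2s`), `n = 1`
  mixed signature (`w = 2σ = a + b`). F13: only `∀ ι ∃ w` is consumed by `RegularTwistCM_of`.
* `S.stub_centralCharacterArch` — T (BJ 4.6/5.7; `n = 0` admitted: `χσ ι = 0`, needs the trivial GL(1)
  datum, exists); L: M (`exists_centralCharacter` + `HasHCParameter.apply_one` + GL(1) dictionary).
* `S.stub_halfIntegralTwist` = route item `HalfIntegralTwistCM` (stmt-Langlands-14036) BY NAME — T (its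
  own Disproof: TRUE as typed; (ii),(iii),(iv), `IsCMField` load-bearing, (i) redundant).
* `S.stub_twistArch` — T (BJ 5.7, AC Ch. 3); L: M/L (Satake half in tree, arch half = general-differential
  `of_map_mulChar_detTwist`); E: `n = 1` is `θ₁θ₂`.
Line `unimodular-normal-form` (namespace `…UnimodularNormalForm`):
* `stub_adjointArchShadow` — as above (input form). `stub_descentArchPackage` — T; NOTE it silently
  CONTAINS `exists_hasInfinityType σ₀` (its shadow hypothesis is an implication over all `χσ`, vacuous
  without existence, while its conclusion asserts `σ₀.1.HasArchParameter _`); per-pair parity (4) is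
  Clozel purity / the mirror (F13: same input).
* `stub_centralDatum` — T for AUTOMORPHIC (not nec. cuspidal) `π`, any `n ≥ 1` (Schur on the irreducible
  `W/W'` + the GL(1) line of `ω_π`; the log-`|det|` junk data of `AutomorphicRepsGLLogDetCounterexample`
  have the parameters of honest constituents, no new case).
* `stub_centralSquareRoot` — T over ANY number field as claimed: locally the half exponents need exactly
  the stated evenness at complex places and NOTHING at real places (sign characters are invisible to HC
  parameters); globally `sqrt_trivial_on_squares` (`η² = ω⁻¹` pointwise ⇒ `η = 1` on `V²`, Weil exponent
  `M ↦ 2M`) + Chevalley. Worked non-CM check (paper): `K = ℚ(∛2)`, `ω_w = (z/z̄)` at the complex place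
  compensated by a Maass parameter `s₁ = i(2πk/N - 2θ)/log ε` at the real place (`ε = 1+∛2+∛4`,
  `θ = arg ε_w`, `e^{iθ}` not a root of unity since `ε⁶ ∉ ℚ`): the half-type exists with `N ↦ 2N`.
* `stub_angularRegulariserCM` — T (`angular_trivial_on_realSquares` + `[𝓞_Kˣ : μ_K 𝓞_{K⁺}ˣ] ≤ 2` +
  Chevalley/Weil (⇐)); the ONLY consumer of `IsCMField` in that line; requests of mixed parity ACROSS
  places are fine (consistent with `cmParity_sufficient`: the parity is repaired place by place here
  because `ψ = ω^{-1/2}` has already made the exponents `±a/2` symmetric).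
* `stub_twistRealisation` — T (as `S.stub_twistArch`; used thrice, incl. `n = 1`).
Line `unitary-mirror-parity` (namespace `…UnitaryMirrorParity`):
* `stub_unitaryMirror` — T for CUSPIDAL data (F11: false for automorphic data); L: L, "provable now" per
  the card (clean model + `A_G`-normalisation + Petersson + `map_neg_conj_of_skewHermitian`). F13: the
  composition uses only `∀ ι ∃ c` — the uniform `∃ c ∀ ι` additionally encodes Weil's parallel real parts
  (`parallel_of_vanishing_on_traceZero`, cycle 1), which `RegularTwistCM_of` never consumes: the stub may
  be LOCALISED, saving the global half of its proof.
* `stub_adjointArchShadow`, `stub_descentInfinityType` (= named fact `exists_hasInfinityType` on `σ₀`; T: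
  every irreducible admissible representation of `GL₂(ℝ)`/`GL₂(ℂ)` has a paired infinitesimal character —
  at a real place `{(u₁,u₁),(u₂,u₂)}` always works, so the pairing has content only at complex places),
  `stub_centralCharacterDatum`, `stub_halfIntegralTwist`, `stub_twistRealisation` — as above.
VERDICT: no stub is an instance of anything refuted in §§2–6; the three compositions honour
`_false_without_IsCMField` (CM consumed once: stub 4 / `stub_angularRegulariserCM` / `HalfIntegralTwistCM`),
`_false_without_RegularAlgebraic` (integrality + `Nodup` of `HC(π)`), F4/F8 (no algebraic / global-power
`χ`), F6 (parity fed by purity, the mirror, or per-pair parity). Kill templates for future stuck stubs are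
unchanged (§4–§5) plus F11 for any mirror-type stub stated for non-cuspidal data.

**F13 (the two levers coincide; uniform constants are dead weight).** On a conj-fixed (e.g. integral)
parameter the mirror map `z ↦ -z̄ + c` IS the purity map `z ↦ c - z` (`mirror_eq_purity_of_real`) and the
constant is an integer (`mirror_constant_integral`): at ONE embedding, "mirror + C-algebraic" (line 3) and
"multiset purity" (line 1) are the same statement about `HC(π)(ι) ⊂ ℤ`, and per-pair parity (line 2, clause
(4)) is its AP-means corollary. Both `S.stub_purity` (`∃ w ∀ ι`) and `UnitaryMirror` (`∃ c ∀ ι`) are consumed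
only per embedding by their compositions — the uniformity (Weil's parallel real parts / Clozel's global
weight) is never used for this crux.

**F14 (sharpness of `π.1.IsRegularAlgebraic`, for planners — not a defect).** Of `HC(π)(ι) =
{a_w + p, p, -a_w + p} ⊂ ℤ`, `Nodup`, the lines use `a_w ∈ ℤ ∖ {0}` (differences) but never `p ∈ ℤ`: the
crux stays true for `π` "regular with integral exponent DIFFERENCES" (e.g. `Ad⁰(σ_alg) ⊗ |det|^{iy}`, not
algebraic), a strictly weaker hypothesis. No action needed; recorded so that nobody spends effort
extracting integrality of the `ν`-exponent.

**F15 (literature, cycle 3).** `lit search` (searchd) rc 75 again (third attempt over cycles 2–3;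
search-degraded, nothing graded on it); `lit galaxy search` bm25 over web PDFs (query: CM field / adjoint
lift regular algebraic / twist cohomological / W- vs L-algebraic / mixed parity): 15 hits (Prasad–
Schulze-Pillot, Vatsal, Ramakrishnan ×2, Weinstein BAMS, Langlands on Arthur, …) — no counter-claim, no
sharpness statement against the CM case. Verdict unchanged: RESISTS.

LANDED this cycle (importable): the sorry-free lemmas below as
`Summits/Langlands/Langlands/Theorems/RegularTwistCM/Negative/MirrorCuspidality.lean` (namespace
`Summit.Langlands.Langlands.Theorems.RegularTwistCM.Negative`, proposal p76103 ACCEPTED, commit 8269223d858a, `--supports`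
stmt-Langlands-14069); the positive `n = 1` base case `unitaryMirror_one` as `…/Negative/UnitaryMirrorGLOne.lean` (p77023
ACCEPTED, commit 0f8d4d687b0c) — the lead may `import` both.
-/

section Cycle3

open scoped ComplexConjugate Classical

/-- MUTATION (F10a): `π` merely AUTOMORPHIC — an irreducible Borel–Jacquet subquotient `W/W'` of the space
of automorphic forms on `GL₃(𝔸_K)`, not necessarily with `W ≤` cusp forms; everything else verbatim. TRUE
on paper (Langlands' Prop. 2 + JS II 4.4: the HC and Satake data of `π` are those of `Ad⁰(σ₀) ⊠ ν` whether
or not `π` is cuspidal), hence NOT refutable; recorded as "cuspidality of `π` possibly unnecessary".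
[cite: JacquetShalikaAJM1981II, Thm. 4.4] -/
def RegularTwistCMAutomorphicPi : Prop :=
  ∀ (K : Type) [Field K] [NumberField K], NumberField.IsCMField K →
    ∀ (h1 : isCompact_glFiniteIntegralLevel 1 K)
    (hcpt₂ : isCompact_glFiniteIntegralLevel 2 K)
    (hcpt : isCompact_glFiniteIntegralLevel 3 K)
    (π : AutomorphicRepData (AutomorphyDatum.gl 3 K hcpt))
    (σ₀ : CuspidalAutomorphicRepData 2 K hcpt₂)
    (ν : CuspidalAutomorphicRepData 1 K h1),
    π.IsRegularAlgebraic →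
    (∀ᶠ v in Filter.cofinite, ∀ α β : Multiset ℂ, π.HasSatakeParamAt v α →
      σ₀.1.HasSatakeParamAt v β → ∃ d : ℂ, ν.1.HasSatakeParamAt v {d} ∧
        α = (((β ×ˢ β).map (fun p : ℂ × ℂ => p.1 * p.2⁻¹)).erase 1).map (fun c => d * c)) →
    ∃ (σ : CuspidalAutomorphicRepData 2 K hcpt₂)
      (χ : CuspidalAutomorphicRepData 1 K h1),
      σ.1.IsRegularAlgebraic ∧ ∀ᶠ v in Filter.cofinite, ∀ β : Multiset ℂ,
        σ₀.1.HasSatakeParamAt v β → ∃ c : ℂ, χ.1.HasSatakeParamAt v {c} ∧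
          σ.1.HasSatakeParamAt v (β.map (fun b => c * b))

/-- F10a implies the crux (restrict to cuspidal `π`). [folklore] -/
theorem crux_of_automorphicPi (h : RegularTwistCMAutomorphicPi) : Crux := by
  intro K _ _ hCM h1 hcpt₂ hcpt π σ₀ ν hRA hAd
  exact h K hCM h1 hcpt₂ hcpt π.1 σ₀ ν hRA hAd

/-- MUTATION (F10b): `σ₀` merely automorphic. TRUE on paper — the new cases are VACUOUS: a non-cuspidal
`σ₀` has Eisenstein Satake parameters `{χ₁(ϖ)q^{-s}, χ₂(ϖ)q^{s}}`, whose `Ad` is the Satake datum of an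
isobaric sum of three Hecke characters, never carried a.e. by a cuspidal `π` (JS II 4.4). NOT refutable;
"cuspidality of `σ₀` possibly unnecessary for truth" (it IS used by every proof: local unitarity / automorphy
of `ω_{σ₀}`, F3). [cite: JacquetShalikaAJM1981II, Thm. 4.4] -/
def RegularTwistCMAutomorphicSigma : Prop :=
  ∀ (K : Type) [Field K] [NumberField K], NumberField.IsCMField K →
    ∀ (h1 : isCompact_glFiniteIntegralLevel 1 K)
    (hcpt₂ : isCompact_glFiniteIntegralLevel 2 K)
    (hcpt : isCompact_glFiniteIntegralLevel 3 K)
    (π : CuspidalAutomorphicRepData 3 K hcpt)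
    (σ₀ : AutomorphicRepData (AutomorphyDatum.gl 2 K hcpt₂))
    (ν : CuspidalAutomorphicRepData 1 K h1),
    π.1.IsRegularAlgebraic →
    (∀ᶠ v in Filter.cofinite, ∀ α β : Multiset ℂ, π.1.HasSatakeParamAt v α →
      σ₀.HasSatakeParamAt v β → ∃ d : ℂ, ν.1.HasSatakeParamAt v {d} ∧
        α = (((β ×ˢ β).map (fun p : ℂ × ℂ => p.1 * p.2⁻¹)).erase 1).map (fun c => d * c)) →
    ∃ (σ : CuspidalAutomorphicRepData 2 K hcpt₂)
      (χ : CuspidalAutomorphicRepData 1 K h1),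
      σ.1.IsRegularAlgebraic ∧ ∀ᶠ v in Filter.cofinite, ∀ β : Multiset ℂ,
        σ₀.HasSatakeParamAt v β → ∃ c : ℂ, χ.1.HasSatakeParamAt v {c} ∧
          σ.1.HasSatakeParamAt v (β.map (fun b => c * b))

/-- F10b implies the crux (restrict to cuspidal `σ₀`). [folklore] -/
theorem crux_of_automorphicSigma (h : RegularTwistCMAutomorphicSigma) : Crux := by
  intro K _ _ hCM h1 hcpt₂ hcpt π σ₀ ν hRA hAd
  exact h K hCM h1 hcpt₂ hcpt π σ₀.1 ν hRA hAd

/-- MUTATION (F10c): BOTH `π` and `σ₀` merely automorphic (the conclusion still asks a CUSPIDAL `σ`). FALSE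
on paper: `μ` of type `(z/|z|)²` over CM `K`, `σ₀ := μ ⊞ 𝟙`, `π := μ ⊞ 𝟙 ⊞ μ⁻¹`, `ν := 𝟙` satisfy the
hypotheses (`eisensteinWitness_HC_regularIntegral`), and no cuspidal `σ` has Satake parameters
`c_v{μ(ϖ_v), 1}` a.e. [cite: JacquetShalikaAJM1981II, Thm. 4.4] -/
def RegularTwistCMAutomorphicBoth : Prop :=
  ∀ (K : Type) [Field K] [NumberField K], NumberField.IsCMField K →
    ∀ (h1 : isCompact_glFiniteIntegralLevel 1 K)
    (hcpt₂ : isCompact_glFiniteIntegralLevel 2 K)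
    (hcpt : isCompact_glFiniteIntegralLevel 3 K)
    (π : AutomorphicRepData (AutomorphyDatum.gl 3 K hcpt))
    (σ₀ : AutomorphicRepData (AutomorphyDatum.gl 2 K hcpt₂))
    (ν : CuspidalAutomorphicRepData 1 K h1),
    π.IsRegularAlgebraic →
    (∀ᶠ v in Filter.cofinite, ∀ α β : Multiset ℂ, π.HasSatakeParamAt v α →
      σ₀.HasSatakeParamAt v β → ∃ d : ℂ, ν.1.HasSatakeParamAt v {d} ∧
        α = (((β ×ˢ β).map (fun p : ℂ × ℂ => p.1 * p.2⁻¹)).erase 1).map (fun c => d * c)) →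
    ∃ (σ : CuspidalAutomorphicRepData 2 K hcpt₂)
      (χ : CuspidalAutomorphicRepData 1 K h1),
      σ.1.IsRegularAlgebraic ∧ ∀ᶠ v in Filter.cofinite, ∀ β : Multiset ℂ,
        σ₀.HasSatakeParamAt v β → ∃ c : ℂ, χ.1.HasSatakeParamAt v {c} ∧
          σ.1.HasSatakeParamAt v (β.map (fun b => c * b))

/-- F10c implies F10a. [folklore] -/
theorem automorphicPi_of_automorphicBoth (h : RegularTwistCMAutomorphicBoth) :
    RegularTwistCMAutomorphicPi := by
  intro K _ _ hCM h1 hcpt₂ hcpt π σ₀ ν hRA hAd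
  exact h K hCM h1 hcpt₂ hcpt π σ₀.1 ν hRA hAd

/-- F10c implies F10b. [folklore] -/
theorem automorphicSigma_of_automorphicBoth (h : RegularTwistCMAutomorphicBoth) :
    RegularTwistCMAutomorphicSigma := by
  intro K _ _ hCM h1 hcpt₂ hcpt π σ₀ ν hRA hAd
  exact h K hCM h1 hcpt₂ hcpt π.1 σ₀ ν hRA hAd

/-- PAPER THEOREM (near-miss, F1): the double mutation is false (Eisenstein witness in the docstring of
`RegularTwistCMAutomorphicBoth`). Obstruction to closing it here: no Eisenstein `GL₂`/`GL₃` Borel–Jacquet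
datum with certified Satake and archimedean parameters is constructible in the tree (only `GL₁` data are:
`exists_automorphicRepData_detTwist_glOne`). [cite: JacquetShalikaAJM1981II, Thm. 4.4] -/
theorem not_RegularTwistCMAutomorphicBoth : ¬ RegularTwistCMAutomorphicBoth := by
  sorry

/-- ARCHIMEDEAN HALF OF THE EISENSTEIN WITNESS (F10c): `{1 + p, p, -1 + p}` with `p ∈ ℤ` is integral and
regular, i.e. regular C-algebraic for `GL₃`, of the adjoint shape with `x - y = 1`. [folklore] -/
theorem eisensteinWitness_HC_regularIntegral (p : ℤ) :
    (∀ z ∈ ({(1 : ℂ) + p, (p : ℂ), -1 + (p : ℂ)} : Multiset ℂ), ∃ k : ℤ, z = k) ∧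
      ({(1 : ℂ) + p, (p : ℂ), -1 + (p : ℂ)} : Multiset ℂ).Nodup := by
  refine ⟨?_, ?_⟩
  · intro z hz
    simp only [Multiset.insert_eq_cons, Multiset.mem_cons, Multiset.mem_singleton] at hz
    rcases hz with rfl | rfl | rfl
    · exact ⟨1 + p, by push_cast; ring⟩
    · exact ⟨p, rfl⟩
    · exact ⟨-1 + p, by push_cast; ring⟩
  · simp only [Multiset.insert_eq_cons, Multiset.nodup_cons, Multiset.mem_cons,
      Multiset.mem_singleton, Multiset.nodup_singleton, and_true, not_or]
    refine ⟨⟨?_, ?_⟩, ?_⟩ <;>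
    · intro h
      have := congrArg Complex.re h
      simp at this
      try linarith

/-- `n = 1` MIRROR ⟺ EQUAL IMAGINARY PARTS (F11): for single exponents `s` (at `ι`) and `t` (at `ῑ`), a
real `c` with `{t} = {-s̄ + c}` exists iff `Im s = Im t`. [folklore] -/
theorem mirror_glOne_iff (s t : ℂ) :
    (∃ c : ℝ, ({t} : Multiset ℂ) = ({s} : Multiset ℂ).map (fun z => -conj z + (c : ℂ))) ↔
      s.im = t.im := by
  constructor
  · rintro ⟨c, hc⟩
    rw [Multiset.map_singleton, Multiset.singleton_inj] at hc
    have := congrArg Complex.im hc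
    simp at this
    linarith
  · intro h
    refine ⟨s.re + t.re, ?_⟩
    rw [Multiset.map_singleton, Multiset.singleton_inj]
    apply Complex.ext <;> simp [h]

/-- The pairing `s - t ∈ ℤ` of a character of `ℂˣ` gives the `n = 1` mirror for free (F11). [folklore] -/
theorem mirror_glOne_of_pairing (s t : ℂ) (h : ∃ m : ℤ, s - t = m) :
    ∃ c : ℝ, ({t} : Multiset ℂ) = ({s} : Multiset ℂ).map (fun z => -conj z + (c : ℂ)) := by
  rw [mirror_glOne_iff]
  obtain ⟨m, hm⟩ := h
  have := congrArg Complex.im hm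
  simp at this
  linarith

/-- OFF-AXIS EISENSTEIN PARAMETERS VIOLATE THE MIRROR (F11: cuspidality is load-bearing in
`UnitaryMirror`): `{s, -s}` is its own mirror image for NO real `c` once `Re s ≠ 0` and `Im s ≠ 0`.
[folklore] -/
theorem mirror_offAxis_obstructed (s : ℂ) (hre : s.re ≠ 0) (him : s.im ≠ 0) :
    ¬ ∃ c : ℝ, ({s, -s} : Multiset ℂ) = ({s, -s} : Multiset ℂ).map (fun z => -conj z + (c : ℂ)) := by
  rintro ⟨c, hc⟩
  simp only [Multiset.insert_eq_cons, Multiset.map_cons, Multiset.map_singleton, map_neg] at hc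
  rw [Multiset.cons_eq_cons] at hc
  rcases hc with ⟨h1, h2⟩ | ⟨-, cs, h2, -⟩
  · rw [Multiset.singleton_inj] at h2
    have e1 := congrArg Complex.re h1
    have e2 := congrArg Complex.re h2
    simp at e1 e2
    apply hre
    linarith
  · rw [Multiset.singleton_eq_cons_iff] at h2
    have e := congrArg Complex.im h2.1
    simp at e
    apply him
    linarith

/-- ON-AXIS PARAMETERS SATISFY THE MIRROR (F11, tightness): `Re s = 0` (tempered) or `Im s = 0` (real
exponents: trivial representation `s = 1/2`, complementary series) give `c = 0`. [folklore] -/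
theorem mirror_onAxis (s : ℂ) (h : s.re = 0 ∨ s.im = 0) :
    ∃ c : ℝ, ({s, -s} : Multiset ℂ) = ({s, -s} : Multiset ℂ).map (fun z => -conj z + (c : ℂ)) := by
  refine ⟨0, ?_⟩
  simp only [Multiset.insert_eq_cons, Multiset.map_cons, Multiset.map_singleton,
    Complex.ofReal_zero, add_zero, map_neg]
  rcases h with h | h
  · have hs : conj s = -s := by apply Complex.ext <;> simp [h]
    rw [hs, neg_neg]
  · have hs : conj s = s := by apply Complex.ext <;> simp [h]
    rw [hs, neg_neg]
    exact Multiset.cons_swap s (-s) 0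

/-- MIRROR = PURITY ON conj-FIXED PARAMETERS (F13). [cite: Clozel1990, Lemme 4.9] -/
theorem mirror_eq_purity_of_real {P : Multiset ℂ} (hP : ∀ z ∈ P, conj z = z) (c : ℂ) :
    P.map (fun z => -conj z + c) = P.map (fun z => c - z) := by
  refine Multiset.map_congr rfl fun z hz => ?_
  rw [hP z hz]
  ring

/-- … with an INTEGRAL constant when both sides are integral and non-empty (F13: the purity weight).
[cite: Clozel1990, Lemme 4.9] -/
theorem mirror_constant_integral {P Q : Multiset ℂ} {c : ℂ} (hP : ∀ z ∈ P, ∃ k : ℤ, z = k)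
    (hQ : ∀ z ∈ Q, ∃ k : ℤ, z = k) (hne : P ≠ 0) (h : Q = P.map (fun z => c - z)) :
    ∃ w : ℤ, c = w := by
  obtain ⟨z, hz⟩ := Multiset.exists_mem_of_ne_zero hne
  obtain ⟨k, rfl⟩ := hP z hz
  have hmem : c - (k : ℂ) ∈ Q := by
    rw [h]
    exact Multiset.mem_map_of_mem _ hz
  obtain ⟨l, hl⟩ := hQ _ hmem
  exact ⟨l + k, by push_cast; linear_combination hl⟩

/-- SQUARE ROOTS LIVE ON SQUARES (F12, mechanism of `stub_centralSquareRoot` over any field): `ω = 1` on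
`V` and `η² = ω⁻¹` pointwise give `η = 1` on `V²`. [cite: Weil1956, unit criterion] -/
theorem sqrt_trivial_on_squares {U M : Type*} [CommGroup U] [CommGroup M] (ω η : U →* M)
    (V : Subgroup U) (hω : ∀ u ∈ V, ω u = 1) (hη : ∀ u, η u ^ 2 = (ω u)⁻¹) {u : U} (hu : u ∈ V) :
    η (u ^ 2) = 1 := by
  rw [map_pow, hη, hω u hu, inv_one]

/-- ANGULAR CHARACTERS DIE ON REAL SQUARES (F12, mechanism of `stub_angularRegulariserCM`): for real
`u ≠ 0` and any `A`, `(u²/|u²|)^A = 1`. [cite: Patrikis2019, Lemma 2.1.5] -/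
theorem angular_trivial_on_realSquares (u : ℝ) (hu : u ≠ 0) (A : ℕ) :
    ((((u : ℂ) ^ 2) / ((‖(u : ℂ) ^ 2‖ : ℝ) : ℂ)) ^ A) = 1 := by
  have hpos : (0 : ℝ) < u ^ 2 := by positivity
  have h2 : ((u : ℂ) ^ 2) = ((u ^ 2 : ℝ) : ℂ) := by push_cast; ring
  rw [h2, Complex.norm_real, Real.norm_of_nonneg hpos.le, div_self, one_pow]
  exact_mod_cast hpos.ne'

end Cycle3

/-! ## §7 Cycle 4 (refuter-cdisprove-stmt-Langlands-14069-g4-0, 2026-08-16): the six stubs of the lead's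
RESHAPED picked skeleton `petersson-hermitian-purity` @ fc20f4a48ad5 as Targets — certificates

(Landing twin: `Theorems/RegularTwistCM/Negative/AdjointShapeCertificates.lean`, same statements in the
namespace `Summit.Langlands.Langlands.Theorems.RegularTwistCM.Negative`.) See F16–F20 in the header.

-- Targets (cycle 4): `stub_adjointArchShadowNonDihedral` (1a) · `stub_dihedralVacuity` (1b) ·
-- `stub_descentInfinityType` (2) · `stub_centralCharacterDatum` (3) · `stub_halfIntegralTwist` (4) ·
-- `stub_twistRealisation` (5): none false, none mis-stated (F16–F18). No `_false` theorem exists to file.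
-/

section Cycle4

open scoped ComplexConjugate Classical

/-- **Stub 1a — the multiplicative adjoint of a pair** (the crux's hypothesis on `β = {X, Y}`, `X, Y ≠ 0`):
`Ad β = {X/Y, Y/X, 1}`. [folklore] -/
theorem ad_pair (X Y : ℂ) (hX : X ≠ 0) (hY : Y ≠ 0) :
    ((({X, Y} : Multiset ℂ) ×ˢ ({X, Y} : Multiset ℂ)).map (fun r : ℂ × ℂ => r.1 * r.2⁻¹)).erase 1 =
      {X * Y⁻¹, Y * X⁻¹, 1} := by
  simp [Multiset.insert_eq_cons, mul_inv_cancel₀ hX, mul_inv_cancel₀ hY]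
  rw [Multiset.cons_swap (X * Y⁻¹) 1, Multiset.erase_cons_head]

/-- **Stub 1a — the additive adjoint of a pair**: `{x - y, y - x, 0}`. [folklore] -/
theorem addAd_pair (x y : ℂ) :
    ((({x, y} : Multiset ℂ) ×ˢ ({x, y} : Multiset ℂ)).map (fun r : ℂ × ℂ => r.1 - r.2)).erase 0 =
      {x - y, y - x, 0} := by
  simp [Multiset.insert_eq_cons]
  rw [Multiset.cons_swap (x - y) 0, Multiset.erase_cons_head]

/-- **Stub 1a's typed conclusion is the `q`-shift of the additive adjoint** (no sign / ordering slip in the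
reshape). [folklore] -/
theorem adjointShape_eq (x y q : ℂ) :
    ({x - y + q, q, y - x + q} : Multiset ℂ) =
      (((({x, y} : Multiset ℂ) ×ˢ ({x, y} : Multiset ℂ)).map (fun r : ℂ × ℂ => r.1 - r.2)).erase 0).map
        (· + q) := by
  rw [addAd_pair]
  simp only [Multiset.insert_eq_cons, Multiset.map_cons, Multiset.map_singleton, zero_add]
  exact congrArg _ (Multiset.cons_swap q (y - x + q) 0)

/-- **Well posed on the multiset `χσ ι = {x, y} = {y, x}`**: the conclusion is symmetric in `x ↔ y`. [folklore] -/
theorem adjointShape_swap (x y q : ℂ) :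
    ({x - y + q, q, y - x + q} : Multiset ℂ) = {y - x + q, q, x - y + q} := by
  simp only [Multiset.insert_eq_cons]
  rw [Multiset.cons_swap (x - y + q) q, Multiset.cons_swap (y - x + q) q]
  exact congrArg _ (Multiset.cons_swap (x - y + q) (y - x + q) 0)

/-- **Degenerate `x = y`** (`Ad{b, b} = {1, 1, 1}`): the conclusion collapses to `{q, q, q}`. [folklore] -/
theorem adjointShape_diag (x q : ℂ) :
    ({x - x + q, q, x - x + q} : Multiset ℂ) = {q, q, q} := by
  simp

/-- **`exp` carries the additive adjoint to the multiplicative one** (Satake/Harish-Chandra consistency of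
the reshaped stub). [folklore] -/
theorem ad_pair_exp (x y : ℂ) :
    ((({Complex.exp x, Complex.exp y} : Multiset ℂ) ×ˢ ({Complex.exp x, Complex.exp y} : Multiset ℂ)).map
        (fun r : ℂ × ℂ => r.1 * r.2⁻¹)).erase 1 =
      ({x - y, y - x, 0} : Multiset ℂ).map Complex.exp := by
  rw [ad_pair _ _ (Complex.exp_ne_zero x) (Complex.exp_ne_zero y)]
  simp only [Multiset.insert_eq_cons, Multiset.map_cons, Multiset.map_singleton, Complex.exp_sub,
    Complex.exp_zero, div_eq_mul_inv]

/-- **Central shadow of stub 1a** (`ω_π = ν³` at `∞`): the adjoint shape sums to `3q`. [folklore] -/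
theorem adjointShape_sum (x y q : ℂ) : ({x - y + q, q, y - x + q} : Multiset ℂ).sum = 3 * q := by
  simp only [Multiset.insert_eq_cons, Multiset.sum_cons, Multiset.sum_singleton]
  ring

/-- **What regularity of `π` gives and no more** (F14 made formal): `Nodup ↔ x ≠ y`. [folklore] -/
theorem adjointShape_nodup_iff (x y q : ℂ) :
    ({x - y + q, q, y - x + q} : Multiset ℂ).Nodup ↔ x ≠ y := by
  constructor
  · intro h hxy
    subst hxy
    simp [Multiset.insert_eq_cons] at h
  · intro hxy
    have ha : x - y ≠ 0 := sub_ne_zero.mpr hxy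
    simp only [Multiset.insert_eq_cons, Multiset.nodup_cons, Multiset.mem_cons,
      Multiset.mem_singleton, Multiset.nodup_singleton, and_true, not_or]
    refine ⟨⟨?_, ?_⟩, ?_⟩ <;> intro h <;> apply ha <;>
      first | linear_combination h | linear_combination h / 2

/-- **What C-algebraicity of `π` gives** (F14 made formal): all entries integral iff `x - y ∈ ℤ ∧ q ∈ ℤ` —
integrality of the `ν`-exponent `q` is free (middle entry) and never consumed. [folklore] -/
theorem adjointShape_integral_iff (x y q : ℂ) :
    (∀ z ∈ ({x - y + q, q, y - x + q} : Multiset ℂ), ∃ k : ℤ, z = k) ↔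
      (∃ k : ℤ, x - y = k) ∧ ∃ k : ℤ, q = k := by
  constructor
  · intro h
    obtain ⟨k₁, hk₁⟩ := h (x - y + q) (by simp)
    obtain ⟨k₂, hk₂⟩ := h q (by simp)
    exact ⟨⟨k₁ - k₂, by push_cast; linear_combination hk₁ - hk₂⟩, k₂, hk₂⟩
  · rintro ⟨⟨k, hk⟩, l, hl⟩ z hz
    simp only [Multiset.insert_eq_cons, Multiset.mem_cons, Multiset.mem_singleton] at hz
    rcases hz with rfl | rfl | rfl
    · exact ⟨k + l, by push_cast; linear_combination hk + hl⟩
    · exact ⟨l, hl⟩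
    · exact ⟨-k + l, by push_cast; linear_combination -hk + hl⟩

/-- **Stub 1b — self-twist at an inert place forces the dihedral shape** (`quadraticSign = -1`): for
`X ≠ 0`, `{X, Y}.map ((-1) * ·) = {X, Y} ↔ Y = -X`. [folklore] -/
theorem selfTwist_pair_iff (X Y : ℂ) (hX : X ≠ 0) :
    ({X, Y} : Multiset ℂ).map (fun a => (-1 : ℂ) * a) = {X, Y} ↔ Y = -X := by
  constructor
  · intro h
    simp only [Multiset.insert_eq_cons, Multiset.map_cons, Multiset.map_singleton, neg_one_mul] at h
    rw [Multiset.cons_eq_cons] at h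
    rcases h with ⟨h1, -⟩ | ⟨-, cs, h2, h3⟩
    · exfalso
      apply hX
      have : (2 : ℂ) * X = 0 := by linear_combination -h1
      simpa using this
    · rw [Multiset.singleton_eq_cons_iff] at h3
      exact h3.1
  · rintro rfl
    simp only [Multiset.insert_eq_cons, Multiset.map_cons, Multiset.map_singleton, neg_one_mul, neg_neg]
    exact Multiset.cons_swap (-X) X 0

/-- **Stub 1b — the adjoint of the dihedral shape is `{-1, -1, 1}`**: under the crux's relation the `GL₃`
Satake datum at every inert place is `d_v · {-1, -1, 1}`, the local component of `ν ⊗ (η_{L/K} ⊞ AI(θ/θᶜ))` —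
locally unobstructed; the negation asserted by 1b is GLOBAL (JS II Thm 4.4), hence neither Lean-refutable
(F1) nor locally mis-stated. [cite: JacquetShalikaAJM1981II, Thm. 4.4] -/
theorem ad_pair_neg (X : ℂ) (hX : X ≠ 0) :
    ((({X, -X} : Multiset ℂ) ×ˢ ({X, -X} : Multiset ℂ)).map (fun r : ℂ × ℂ => r.1 * r.2⁻¹)).erase 1 =
      {-1, -1, 1} := by
  rw [ad_pair X (-X) hX (neg_ne_zero.mpr hX)]
  simp [mul_inv_cancel₀ hX, inv_neg]

/-- **Stub 2 — no content at conjugation-fixed embeddings**: if every embedding of `K` is real, any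
automorphic `π` on `GL_n(𝔸_K)` with an archimedean parameter `χ` has the well-formed infinity type
`σ ↦ {(x, x) : x ∈ χ σ}`. Over the crux's CM field ALL of `exists_hasInfinityType` is therefore the integral
pairing `χ σ ↔ χ σ̄` at complex places (carried by `ArchWeight.exists_int_sub`, not by `IsWellFormed`).
[cite: Clozel1990, §3.3] -/
theorem exists_hasInfinityType_of_conjugate_eq {n : ℕ} {K : Type} [Field K] [NumberField K]
    {hcpt : isCompact_glFiniteIntegralLevel n K}
    (hK : ∀ σ : K →+* ℂ, NumberField.ComplexEmbedding.conjugate σ = σ)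
    {π : AutomorphicRepData (AutomorphyDatum.gl n K hcpt)} {χ : (K →+* ℂ) → Multiset ℂ}
    (h : π.HasArchParameter χ) : π.exists_hasInfinityType := by
  refine ⟨fun σ => (χ σ).map (fun x => (⟨x, x, 0, by simp⟩ : ArchWeight)), ⟨fun σ => ?_, fun σ => ?_⟩, ?_⟩
  · rw [Multiset.card_map]
    exact AutomorphicRepData.card_eq_of_hasArchParameter h σ
  · rw [hK σ, Multiset.map_map]
    rfl
  · have hfun : (fun σ => ((χ σ).map (fun x => (⟨x, x, 0, by simp⟩ : ArchWeight))).map ArchWeight.a) = χ := by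
      funext σ
      rw [Multiset.map_map]
      conv_rhs => rw [← Multiset.map_id (χ σ)]
      rfl
    rw [hfun]
    exact h

/-- **Stub 2 over a totally real field** reduces to the bare existence of an archimedean parameter.
[cite: Clozel1990, §3.3] -/
theorem exists_hasInfinityType_of_isTotallyReal {n : ℕ} {K : Type} [Field K] [NumberField K]
    [NumberField.IsTotallyReal K] {hcpt : isCompact_glFiniteIntegralLevel n K}
    {π : AutomorphicRepData (AutomorphyDatum.gl n K hcpt)} {χ : (K →+* ℂ) → Multiset ℂ}
    (h : π.HasArchParameter χ) : π.exists_hasInfinityType := by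
  refine exists_hasInfinityType_of_conjugate_eq (fun σ => ?_) h
  exact NumberField.ComplexEmbedding.isReal_iff.mp
    (NumberField.InfinitePlace.isReal_mk_iff.mp
      (NumberField.IsTotallyReal.isReal (NumberField.InfinitePlace.mk σ)))

/-- **Stub 3 holds verbatim at `n = 1`** (`card (P ι) = 1`, `ω := π`). [folklore] -/
theorem centralCharacterDatum_glOne (K : Type) [Field K] [NumberField K]
    (h1 hcpt : isCompact_glFiniteIntegralLevel 1 K) (π : CuspidalAutomorphicRepData 1 K hcpt)
    (P : (K →+* ℂ) → Multiset ℂ) (hP : π.1.HasArchParameter P) :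
    ∃ ω : CuspidalAutomorphicRepData 1 K h1, ω.1.HasArchParameter (fun ι => {(P ι).sum}) := by
  have hfun : (fun ι => ({(P ι).sum} : Multiset ℂ)) = P := by
    funext ι
    obtain ⟨x, hx⟩ := Multiset.card_eq_one.mp (AutomorphicRepData.card_eq_of_hasArchParameter hP ι)
    rw [hx, Multiset.sum_singleton]
  refine ⟨π, ?_⟩
  rw [hfun]
  exact hP

/-- **Stub 3 (verbatim antecedent, all `n`) implies the SUM PAIRING** `Σ P(σ_w) - Σ P(σ̄_w) ∈ ℤ` at every
complex place, for every cuspidal `GL_n` datum with a parameter — true on paper (central character on `ℂˣ`),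
consistent with stub 2; a mis-normalised central-character stub would be exposed here.
[cite: TateThesis1967, §2.3] -/
theorem sumPairing_of_centralCharacterDatum
    (h3 : ∀ (n : ℕ) [NeZero n] (K : Type) [Field K] [NumberField K]
      (h1 : isCompact_glFiniteIntegralLevel 1 K) (hcpt : isCompact_glFiniteIntegralLevel n K)
      (π : CuspidalAutomorphicRepData n K hcpt) (P : (K →+* ℂ) → Multiset ℂ), π.1.HasArchParameter P →
      ∃ ω : CuspidalAutomorphicRepData 1 K h1, ω.1.HasArchParameter (fun ι => {(P ι).sum}))
    (n : ℕ) [NeZero n] (K : Type) [Field K] [NumberField K]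
    (h1 : isCompact_glFiniteIntegralLevel 1 K) (hcpt : isCompact_glFiniteIntegralLevel n K)
    (π : CuspidalAutomorphicRepData n K hcpt) (P : (K →+* ℂ) → Multiset ℂ)
    (hP : π.1.HasArchParameter P) (w : {w : NumberField.InfinitePlace K // w.IsComplex}) :
    ∃ m : ℤ, (P w.1.embedding).sum - (P (NumberField.ComplexEmbedding.conjugate w.1.embedding)).sum = m := by
  obtain ⟨ω, hω⟩ := h3 n K h1 hcpt π P hP
  obtain ⟨p, q, m, hp, hq, hm⟩ :=
    Summit.Langlands.Langlands.Theorems.HalfIntegralTwistCM.Negative.archParam_embedding_sub_conj_mem_int_glOne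
      ω.1 hω w
  refine ⟨m, ?_⟩
  rw [Multiset.singleton_inj] at hp hq
  rw [hp, hq, hm]

end Cycle4

end Summit.Langlands.Langlands.Cruxes.RegularTwistCM.Disproof
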